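import Literature.Analysis.FluidPDE.TaoMultiplierToolkit
import Literature.Analysis.FluidPDE.TaoCascadeWaveletFourier
import Literature.Analysis.FluidPDE.TaoAveragedConjugation
import Literature.Analysis.FluidPDE.TaoBandHeatGroup
import Literature.Analysis.FluidPDE.TaoMildSolutionBounds
import Literature.Analysis.FunctionSpaces.FourierSobolevNormProofs
import Mathlib.Analysis.Calculus.ParametricIntegral
import Mathlib.MeasureTheory.Integral.IntervalIntegral.FundThmCalculus
import Mathlib.Analysis.SpecialFunctions.ExpDeriv
import HarnessLib

/-!
# Tao's averaged Navier–Stokes blow-up: the Duhamel representation of the modes (proof of Lemma 4.1, analytic core)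

T. Tao, *Finite time blowup for an averaged three-dimensional Navier–Stokes equation*,
J. Amer. Math. Soc. **29** (2016), 601–674 = arXiv:1402.0290v3 (held as `paper:arxiv-1402.0290`),
§4, proof of Lemma 4.1, p. 22: "As `u` is a mild solution to (3.3), we have (4.14) … Taking
inner products of (4.14) with `ψ_{i,n}`, we have
`u_{i,n}(t) = e^{tΔ} X_{i,n}(0) ψ_{i,n} + ∑ α (1+ε₀)^{5(n-μ₃)/2} ∫₀ᵗ X X (t') e^{(t-t')Δ} ψ_{i,n} dt'`,
or in differentiated form (4.15) … this shows that `u_{i,n}` is continuously differentiable in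
time … From Cauchy–Schwarz we have `½ X_{i,n}² ≤ E_{i,n}` … `⟨Δu_{i,n}, ψ_{i,n}⟩ = O((1+ε₀)^{2n} E_{i,n}^{1/2})`".

This file carries out that paragraph for the accepted objects of `TaoCascadeMotion.lean`
(`modeProjection`, `modeCoeff`, `modeEnergy`, `equationsOfMotion` = Lemma 4.1 as a named fact),
over `TaoCascadeProjection.lean`, `TaoCascadeWaveletFourier.lean` and `TaoMultiplierToolkit.lean`.
Everything is **proved**; the remaining bookkeeping ((4.6)–(4.12) in the format of
`TaoCascade.CascadeODESolution`, and the assembly of `equationsOfMotion`) is the next file.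

* **Regularity of mild solutions in `L²`** (§III): `continuousOn_modeCoeff`,
  `ContinuousInH10On.exists_bound` (the `H¹⁰` norm is locally bounded), pairing algebra and
  Cauchy–Schwarz `norm_pairing_le` (the seminorm facts `eFourierSobolevNorm_add_le`, … and
  `ContinuousInH10On.continuousOn` are those of `TaoMildSolutionBounds.lean`; the heat rate
  `heatRate` and `IsFourierDivFree.add/.smul` are those of `TaoBandHeatGroup.lean`).
* **The weak Duhamel identity** (§IV): `pairing_modeProjection_eq_of_isMildSolutionFor` — for a
  global mild solution with datum `ψ_{i₀,n₀}`, `t ≥ 0`, `w ∈ H¹⁰_df`: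
  `⟨P_{i,n}u(t), w⟩ = 1_{(i,n)=(i₀,n₀)}⟨e^{tΔ}ψ_{i,n}, w⟩ + ∫₀ᵗ quadTerm_{i,n}(u(s)) ⟨e^{(t-s)Δ}ψ_{i,n}, w⟩ ds`
  (test (3.3) against `P_{i,n}w ∈ H¹⁰_df`; the band-limited `e^{(t-s)Δ}P_{i,n}w` collapses `⟨C(u,u),·⟩`,
  `cascadeOperatorForm_eq_quadTermC_mul`; orthogonality `modeProjection_cascadeWavelet`).
* **The Duhamel field** (§V–VI): `duhamelSymbolFn Q t ξ = ∫₀ᵗ Q(s)e^{-4π²(t-s)|ξ|²}ds`, its `L^∞` class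
  `duhamelSymbol`, the Fubini identity `pairing_fourierMultiplier_duhamelSymbol`
  (`⟨M_t(D)v, w⟩ = ∫₀ᵗ Q(s)⟨e^{(t-s)Δ}v, w⟩ds`), the mode forcing `modeForcing` (complex, continuous on
  `ℝ`, real on real curves), `duhamelModeField F_{i,n}(t) = 1_{(i,n)=(i₀,n₀)} e^{tΔ}ψ_{i,n} + M_t(D)ψ_{i,n}`,
  `memH10df_duhamelModeField`, and **the identification `modeProjection_eq_duhamelModeField`:
  `P_{i,n}u(t) = F_{i,n}(t)`** (both in `H¹⁰_df`, same pairings against `H¹⁰_df`, test the difference).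
* **Frequency-integral formulas** (§VII): `modeCoeff_eq_integral`, `modeEnergy_eq_integral`:
  `X_{i,n}(t) = ∫ Re m_t |ψ̂_{i,n}|²`, `E_{i,n}(t) = ½∫ (Re m_t)² |ψ̂_{i,n}|²`, `m_t = δ e^{-4π²t|ξ|²} + M_t`.
* **Scalar calculus** (§VIII–X): `duhamelScalar φ_L(t) = e^{-Lt}(δ + ∫₀ᵗ Qr e^{Ls})` with
  `φ' = -Lφ + Qr` (`hasDerivAt_duhamelScalar`); dominated **differentiation under the frequency
  integral** `hasDerivAt_integral_duhamelScalar_pow`; `modeScalarX/E` (= `X_{i,n}, E_{i,n}` on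
  `[0,∞)`: `modeCoeff_eq_modeScalarX`, `modeEnergy_eq_modeScalarE`) with
  `X̃' = -A + Qr` (`hasDerivAt_modeScalarX`), `Ẽ' = -B + Qr X̃` (`hasDerivAt_modeScalarE`), `B ≥ 0`,
  and the Cauchy–Schwarz estimates `half_sq_modeScalarX_le` (**(4.12), lower half**) and
  `abs_modeDissX_le` (`|A| ≤ Λ_n (2Ẽ)^{1/2}`, the `O((1+ε₀)^{2n}E^{1/2})` of (4.10)).

## Design notes

* `M_t(D)ψ` is an honest `fourierMultiplier` (no Bochner integrals in `L²` are needed); the time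
  integral is moved inside the pairing by Fubini on `[0,t] × ℝ³`.
* Values at negative times: the forcing is frozen at its value at `0` (`modeForcing`), which makes
  the scalar functions smooth on all of `ℝ`; only `[0,t]` is ever integrated over.
* The identification needs no density argument: `P_{i,n}u(t) - F_{i,n}(t) ∈ H¹⁰_df` is itself a
  test field, and a real field orthogonal to itself vanishes.

## References

* T. Tao, J. Amer. Math. Soc. 29 (2016), 601–674, arXiv:1402.0290v3, §4 Lemma 4.1, pp. 21–22,
  (3.3), (4.5), (4.10)–(4.12), (4.14)–(4.15). Key `Tao2016AveragedNS`.
-/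

noncomputable section

open MeasureTheory Set Filter FourierTransform Metric
open scoped ENNReal NNReal SchwartzMap Topology RealInnerProductSpace Pointwise ComplexConjugate

namespace Literature.Analysis.FluidPDE.Tao2016

/-! ## Part III: regularity of mild solutions in `L²` -/

section MildRegularity2

variable {I : Set ℝ} {u : ℝ → L2C}

/-- The pairing is subtractive in its first argument. [folklore] -/
theorem pairing_sub_left (u v w : L2C) : pairing (u - v) w = pairing u w - pairing v w := by
  simp only [pairing_eq_inner_conjL2, inner_sub_right]

/-- The pairing is additive in its first argument. [folklore] -/
theorem pairing_add_left (u v w : L2C) : pairing (u + v) w = pairing u w + pairing v w := by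
  simp only [pairing_eq_inner_conjL2, inner_add_right]

/-- The pairing is homogeneous in its first argument. [folklore] -/
theorem pairing_smul_left (c : ℂ) (u w : L2C) : pairing (c • u) w = c * pairing u w := by
  simp only [pairing_eq_inner_conjL2, inner_smul_right]

/-- Conjugation does not increase the `L²` norm. [folklore] -/
theorem norm_conjL2_le (w : L2C) : ‖conjL2 w‖ ≤ ‖w‖ := by
  unfold conjL2
  refine (ContinuousLinearMap.norm_compLp_le _ _).trans ?_
  refine mul_le_of_le_one_left (norm_nonneg _) ?_
  exact conj3.toContinuousLinearMap.opNorm_le_bound zero_le_one fun z => by simp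

/-- **Cauchy–Schwarz for the pairing**: `|⟨u, w⟩| ≤ ‖u‖ ‖w‖`. [folklore] -/
theorem norm_pairing_le (u w : L2C) : ‖pairing u w‖ ≤ ‖u‖ * ‖w‖ := by
  rw [pairing_eq_inner_conjL2]
  refine (norm_inner_le_norm _ _).trans ?_
  rw [mul_comm]
  exact mul_le_mul_of_nonneg_left (norm_conjL2_le w) (norm_nonneg _)

/-- Pairing against a fixed field is a continuous linear functional; along an `L²`-continuous
curve it is continuous. [folklore] -/
theorem ContinuousOn.pairing_left {I : Set ℝ} {u : ℝ → L2C} (hu : ContinuousOn u I) (w : L2C) :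
    ContinuousOn (fun t => pairing (u t) w) I := by
  have h : (fun t => pairing (u t) w) = (innerSL ℂ (conjL2 w)) ∘ u := by
    funext t
    simp [pairing_eq_inner_conjL2]
  rw [h]
  exact (innerSL ℂ (conjL2 w)).continuous.comp_continuousOn hu

variable {ε₀ : ℝ} {m : ℕ}

/-- **The coefficients `X_{i,n}` of a mild solution are continuous on `[0,+∞)`.** [cite: Tao2016AveragedNS, Lemma 4.1] -/
theorem continuousOn_modeCoeff (𝒟 : CascadeWaveletData ε₀ m) {I : Set ℝ} {u : ℝ → L2C}
    (hu : ContinuousInH10On I u) (j : Fin m) (k : ℤ) : ContinuousOn (modeCoeff 𝒟 u j k) I :=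
  Complex.continuous_re.comp_continuousOn (ContinuousOn.pairing_left hu.continuousOn _)

/-- **The `H¹⁰` norm of an `H¹⁰`-continuous curve is locally bounded**: on a compact time
interval where it is finite, `sup_t ‖u(t)‖_{H¹⁰} < ∞` (Tao, p. 22: "from the a priori regularity
`u ∈ C⁰_t H¹⁰_x`"). [cite: Tao2016AveragedNS, Lemma 4.1 (4.6)] -/
theorem ContinuousInH10On.exists_bound {a b : ℝ} {u : ℝ → L2C} (hu : ContinuousInH10On (Icc a b) u)
    (hfin : ∀ t ∈ Icc a b, FunctionSpaces.eFourierSobolevNorm 10 (u t) < ∞) :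
    ∃ M : ℝ, ∀ t ∈ Icc a b, (FunctionSpaces.eFourierSobolevNorm 10 (u t)).toReal ≤ M := by
  set f : ℝ → ℝ := fun t => (FunctionSpaces.eFourierSobolevNorm 10 (u t)).toReal with hf
  have hcont : ContinuousOn f (Icc a b) := by
    intro t₀ ht₀
    rw [ContinuousWithinAt, tendsto_iff_norm_sub_tendsto_zero]
    have h := hu t₀ ht₀
    have h0 : Tendsto (fun t => (FunctionSpaces.eFourierSobolevNorm 10 (u t - u t₀)).toReal)
        (𝓝[Icc a b] t₀) (𝓝 0) := by
      rw [← ENNReal.toReal_zero]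
      exact (ENNReal.tendsto_toReal ENNReal.zero_ne_top).comp h
    have hfin' : ∀ᶠ t in 𝓝[Icc a b] t₀, FunctionSpaces.eFourierSobolevNorm 10 (u t - u t₀) < 1 :=
      h (gt_mem_nhds zero_lt_one)
    refine squeeze_zero' (Eventually.of_forall fun t => norm_nonneg _) ?_ h0
    filter_upwards [hfin', eventually_mem_nhdsWithin] with t ht htI
    have hA := hfin t htI
    have hB := hfin t₀ ht₀
    have hD : FunctionSpaces.eFourierSobolevNorm 10 (u t - u t₀) ≠ ⊤ := ht.ne_top
    have h1 : FunctionSpaces.eFourierSobolevNorm 10 (u t) ≤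
        FunctionSpaces.eFourierSobolevNorm 10 (u t₀) + FunctionSpaces.eFourierSobolevNorm 10 (u t - u t₀) := by
      have := eFourierSobolevNorm_add_le 10 (u t₀) (u t - u t₀)
      rwa [add_sub_cancel] at this
    have h2 : FunctionSpaces.eFourierSobolevNorm 10 (u t₀) ≤
        FunctionSpaces.eFourierSobolevNorm 10 (u t) + FunctionSpaces.eFourierSobolevNorm 10 (u t - u t₀) := by
      have := eFourierSobolevNorm_add_le 10 (u t) (u t₀ - u t)
      rw [add_sub_cancel, eFourierSobolevNorm_sub_comm] at this
      exact this
    rw [hf, Real.norm_eq_abs, abs_sub_le_iff]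
    simp only
    constructor
    · have := ENNReal.toReal_mono (ENNReal.add_ne_top.2 ⟨hB.ne, hD⟩) h1
      rw [ENNReal.toReal_add hB.ne hD] at this
      linarith
    · have := ENNReal.toReal_mono (ENNReal.add_ne_top.2 ⟨hA.ne, hD⟩) h2
      rw [ENNReal.toReal_add hA.ne hD] at this
      linarith
  obtain ⟨C, hC⟩ := isCompact_Icc.exists_bound_of_continuousOn hcont
  exact ⟨C, fun t ht => (le_abs_self _).trans ((Real.norm_eq_abs _).symm.trans_le (hC t ht))⟩

end MildRegularity2

/-! ## Part IV: band limitation; the Duhamel identity for the projected solution -/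

section Support

variable {ε₀ : ℝ} {m : ℕ} {𝒟 : CascadeWaveletData ε₀ m}

/-- The wavelet `ψ_{i,n}` is band-limited to its frequency region (tree `IsBandLimited`). [cite: Tao2016AveragedNS, Lemma 4.1] -/
theorem isBandLimited_cascadeWavelet (hε : 0 < 1 + ε₀) (i : Fin m) (n : ℤ) :
    IsBandLimited (freqRegion 𝒟 i n) (cascadeWavelet ε₀ (𝒟.ψ i) n) :=
  𝒟.fourierFn_cascadeWavelet_eq_zero hε i n

/-- The projection `P_{i,n} u` is band-limited to the region. [cite: Tao2016AveragedNS, Lemma 4.1] -/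
theorem isBandLimited_modeProjection (i : Fin m) (n : ℤ) (u : L2C) :
    IsBandLimited (freqRegion 𝒟 i n) (modeProjection 𝒟 i n u) := by
  unfold IsBandLimited
  filter_upwards [fourierFn_modeProjection 𝒟 i n u] with ξ hξ hnot
  rw [hξ, indicator_of_notMem hnot, zero_smul]

/-- Band limitation is preserved by the heat flow (a Fourier multiplier). [folklore] -/
theorem IsBandLimited.heat {A : Set (EuclideanSpace ℝ (Fin 3))} {v : L2C}
    (h : IsBandLimited A v) (τ : ℝ) : IsBandLimited A (heat τ v) :=
  h.fourierMultiplier _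

/-- **A field frequency-supported in `A_{i,n}` pairs to zero with every other wavelet**
`ψ_{j,k}`, `(j,k) ≠ (i,n)` (the dilated balls are disjoint, Tao p. 22). [cite: Tao2016AveragedNS, Lemma 4.1] -/
theorem IsBandLimited.pairing_cascadeWavelet_eq_zero (hε : 0 < ε₀) {i : Fin m} {n : ℤ} {v : L2C}
    (h : IsBandLimited (freqRegion 𝒟 i n) v) {j : Fin m} {k : ℤ} (hne : (j, k) ≠ (i, n)) :
    pairing v (cascadeWavelet ε₀ (𝒟.ψ j) k) = 0 := by
  have hε' : 0 < 1 + ε₀ := by linarith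
  rw [pairing_eq_integral_fourierFn (isReal_cascadeWavelet ε₀ (𝒟.ψ j) k)]
  refine (integral_congr_ae ?_).trans (integral_zero _ _)
  filter_upwards [h, 𝒟.fourierFn_cascadeWavelet_eq_zero hε' j k] with ξ h1 h2
  by_cases hξ : ξ ∈ freqRegion 𝒟 i n
  · rw [h2 (𝒟.not_mem_freqRegion_of_ne hε (Ne.symm hne) hξ), inner_zero_left]
  · rw [h1 hξ, inner_zero_right]

/-- **The projection on the wavelets**: `P_{i,n} ψ_{j,k} = 1_{(j,k)=(i,n)} ψ_{j,k}`. [cite: Tao2016AveragedNS, Lemma 4.1] -/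
theorem modeProjection_cascadeWavelet (hε : 0 < ε₀) (i j : Fin m) (n k : ℤ) :
    modeProjection 𝒟 i n (cascadeWavelet ε₀ (𝒟.ψ j) k) =
      if j = i ∧ k = n then cascadeWavelet ε₀ (𝒟.ψ j) k else 0 := by
  have hε' : 0 < 1 + ε₀ := by linarith
  apply eq_of_fourierFn_ae_eq
  split_ifs with hjk
  · obtain ⟨rfl, rfl⟩ := hjk
    filter_upwards [fourierFn_modeProjection 𝒟 j k (cascadeWavelet ε₀ (𝒟.ψ j) k),
      𝒟.fourierFn_cascadeWavelet_eq_zero hε' j k] with ξ h1 h2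
    rw [h1]
    by_cases hξ : ξ ∈ freqRegion 𝒟 j k
    · rw [indicator_of_mem hξ, one_smul]
    · rw [indicator_of_notMem hξ, zero_smul, h2 hξ]
  · filter_upwards [fourierFn_modeProjection 𝒟 i n (cascadeWavelet ε₀ (𝒟.ψ j) k),
      𝒟.fourierFn_cascadeWavelet_eq_zero hε' j k, fourierFn_zero] with ξ h1 h2 h3
    rw [h1, h3, Pi.zero_apply]
    by_cases hξ : ξ ∈ freqRegion 𝒟 i n
    · rw [h2 (𝒟.not_mem_freqRegion_of_ne hε (fun h => hjk ⟨(Prod.mk.inj h).1.symm,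
        (Prod.mk.inj h).2.symm⟩) hξ), smul_zero]
    · rw [indicator_of_notMem hξ, zero_smul]

/-- `⟨e^{τΔ} P_{i,n} w, ψ_{i,n}⟩ = ⟨w, e^{τΔ} ψ_{i,n}⟩` (`P` and `e^{τΔ}` commute and are
self-adjoint, `P ψ_{i,n} = ψ_{i,n}`). [cite: Tao2016AveragedNS, Lemma 4.1] -/
theorem pairing_heat_modeProjection_cascadeWavelet (hε : 0 < ε₀) (τ : ℝ) (w : L2C) (i : Fin m) (n : ℤ) :
    pairing (heat τ (modeProjection 𝒟 i n w)) (cascadeWavelet ε₀ (𝒟.ψ i) n) =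
      pairing w (heat τ (cascadeWavelet ε₀ (𝒟.ψ i) n)) := by
  rw [← modeProjection_heat, pairing_modeProjection_left, modeProjection_cascadeWavelet hε,
    if_pos ⟨rfl, rfl⟩, pairing_heat_left]

/-- The free evolution of the datum seen by the mode `(i,n)`:
`⟨e^{tΔ} ψ_{i₀,n₀}, P_{i,n} w⟩ = 1_{(i,n)=(i₀,n₀)} ⟨e^{tΔ} ψ_{i,n}, w⟩`. [cite: Tao2016AveragedNS, Lemma 4.1 (4.14)] -/
theorem pairing_heat_datum_modeProjection (hε : 0 < ε₀) (t : ℝ) (w : L2C) (i₀ i : Fin m) (n₀ n : ℤ) :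
    pairing (heat t (cascadeWavelet ε₀ (𝒟.ψ i₀) n₀)) (modeProjection 𝒟 i n w) =
      (if i₀ = i ∧ n₀ = n then 1 else 0) * pairing (heat t (cascadeWavelet ε₀ (𝒟.ψ i) n)) w := by
  rw [← pairing_modeProjection_left, modeProjection_heat, modeProjection_cascadeWavelet hε]
  split_ifs with h
  · obtain ⟨rfl, rfl⟩ := h
    rw [one_mul]
  · rw [heat_apply_zero, pairing_zero_left, zero_mul]

/-- **The Duhamel identity for the projected solution** (Tao, p. 22, the display after (4.14):
`u_{i,n}(t) = e^{tΔ} X_{i,n}(0) ψ_{i,n} + ∑ α (1+ε₀)^{5(n-μ₃)/2} ∫₀ᵗ X X (t') e^{(t-t')Δ} ψ_{i,n} dt'`),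
in the weak form in which the mild formulation (3.3) is stated: for `t ≥ 0` and every test field
`w ∈ H¹⁰_df`,
`⟨P_{i,n} u(t), w⟩ = 1_{(i,n)=(i₀,n₀)} ⟨e^{tΔ}ψ_{i,n}, w⟩ + ∫₀ᵗ quadTerm_{i,n}(u(s)) ⟨e^{(t-s)Δ}ψ_{i,n}, w⟩ ds`.
Proof: test (3.3) against `P_{i,n} w ∈ H¹⁰_df`; the free term is
`pairing_heat_datum_modeProjection`; in the Duhamel term, `e^{(t-s)Δ} P_{i,n} w` is frequency
supported in `A_{i,n}`, so `⟨C(u,u), ·⟩` collapses (`cascadeOperatorForm_eq_quadTermC_mul`). [cite: Tao2016AveragedNS, Lemma 4.1 (4.14)] -/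
theorem pairing_modeProjection_eq_of_isMildSolutionFor (hε : 0 < ε₀)
    {α : Fin m → Fin m → Fin m → ℤ × ℤ × ℤ → ℝ} {i₀ : Fin m} {n₀ : ℤ} {u : ℝ → L2C}
    (hu : IsMildSolutionFor (cascadeOperatorForm ε₀ 𝒟.ψ α) (cascadeWavelet ε₀ (𝒟.ψ i₀) n₀) (Ici 0) u)
    (i : Fin m) (n : ℤ) {t : ℝ} (ht : 0 ≤ t) {w : L2C} (hw : MemH10df w) :
    pairing (modeProjection 𝒟 i n (u t)) w =
      (if i₀ = i ∧ n₀ = n then 1 else 0) * pairing (heat t (cascadeWavelet ε₀ (𝒟.ψ i) n)) w +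
        ∫ s in (0 : ℝ)..t, quadTermC ε₀ 𝒟.ψ α (u s) i n *
          pairing (heat (t - s) (cascadeWavelet ε₀ (𝒟.ψ i) n)) w := by
  rw [pairing_modeProjection_left, hu.2.2 t ht _ (hw.modeProjection 𝒟 i n),
    pairing_heat_datum_modeProjection hε]
  congr 1
  refine intervalIntegral.integral_congr fun s _ => ?_
  rw [cascadeOperatorForm_eq_quadTermC_mul (i := i) (n := n),
    pairing_heat_modeProjection_cascadeWavelet hε, pairing_swap w]
  intro j k hne
  exact ((isBandLimited_modeProjection i n w).heat (t - s)).pairing_cascadeWavelet_eq_zero hε hne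

end Support

/-! ## Part V: the Duhamel field `m_t(D) ψ_{i,n}` and Fubini -/

section DuhamelField

/-- The heat symbol is jointly continuous in `(τ, ξ)`. [folklore] -/
theorem continuous_heatSymbol₂ :
    Continuous fun p : ℝ × EuclideanSpace ℝ (Fin 3) => heatSymbol p.1 p.2 := by
  unfold heatSymbol
  fun_prop

/-- The Fourier-side density `ξ ↦ v̂(ξ) · ŵ(-ξ)` of the pairing `⟨v, w⟩` is integrable: it is
the pointwise inner product of the two `L²` fields `\overline{v̂}` and `ŵ(-·)`. [folklore] -/
theorem integrable_cdot_fourierFn (v w : L2C) :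
    Integrable (fun ξ : EuclideanSpace ℝ (Fin 3) => cdot (fourierFn v ξ) (fourierFn w (-ξ))) := by
  have h := MeasureTheory.L2.integrable_inner (𝕜 := ℂ) (conjL2 (𝓕 v : L2C)) (reflectL2 (𝓕 w : L2C))
  refine h.congr ?_
  filter_upwards [coeFn_conjL2 (𝓕 v : L2C), coeFn_reflectL2 (𝓕 w : L2C)] with ξ h1 h2
  change inner ℂ ((conjL2 (𝓕 v : L2C) : EuclideanSpace ℝ (Fin 3) → EuclideanSpace ℂ (Fin 3)) ξ)
    ((reflectL2 (𝓕 w : L2C) : EuclideanSpace ℝ (Fin 3) → EuclideanSpace ℂ (Fin 3)) ξ) =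
    cdot (fourierFn v ξ) (fourierFn w (-ξ))
  rw [h1, h2]
  simp only [cdot, PiLp.inner_apply, RCLike.inner_apply, conj3_apply, Complex.conj_conj, fourierFn]
  exact Finset.sum_congr rfl fun i _ => mul_comm _ _

/-- The pairing of a Fourier multiplier output: `⟨m(D)v, w⟩ = ∫ m(ξ) (v̂(ξ) · ŵ(-ξ)) dξ`. [folklore] -/
theorem pairing_fourierMultiplier_eq_integral (msymb : Lp ℂ ∞ (volume : Measure (EuclideanSpace ℝ (Fin 3))))
    (v w : L2C) :
    pairing (fourierMultiplier msymb v) w =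
      ∫ ξ, (msymb : EuclideanSpace ℝ (Fin 3) → ℂ) ξ * cdot (fourierFn v ξ) (fourierFn w (-ξ)) := by
  rw [pairing_eq_integral_cdot_fourierFn]
  refine integral_congr_ae ?_
  have hleft : ∀ (c : ℂ) (a b : EuclideanSpace ℂ (Fin 3)), cdot (c • a) b = c * cdot a b :=
    fun c a b => by simp [cdot, Finset.mul_sum, mul_assoc]
  filter_upwards [fourierFn_fourierMultiplier msymb v] with ξ hξ
  rw [hξ, hleft]

/-- The pairing of a heat-flowed field: `⟨e^{τΔ}v, w⟩ = ∫ e^{-4π²τ|ξ|²} (v̂(ξ) · ŵ(-ξ)) dξ`. [folklore] -/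
theorem pairing_heat_eq_integral (τ : ℝ) (v w : L2C) :
    pairing (heat τ v) w = ∫ ξ, heatSymbol τ ξ * cdot (fourierFn v ξ) (fourierFn w (-ξ)) := by
  rw [heat, pairing_fourierMultiplier_eq_integral]
  refine integral_congr_ae ?_
  filter_upwards [MemLp.coeFn_toLp (memLp_top_heatSymbol τ)] with ξ hξ
  rw [hξ]

variable (Q : ℝ → ℂ)

/-- The **Duhamel symbol** `M_t(ξ) = ∫₀ᵗ Q(s) e^{-4π²(t-s)|ξ|²} ds` of the forcing `Q` (the Fourier
multiplier by which `∫₀ᵗ Q(s) e^{(t-s)Δ} ψ ds` acts on `ψ`). [cite: Tao2016AveragedNS, Lemma 4.1 (4.14)] -/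
def duhamelSymbolFn (t : ℝ) (ξ : EuclideanSpace ℝ (Fin 3)) : ℂ :=
  ∫ s in (0 : ℝ)..t, Q s * heatSymbol (t - s) ξ

variable {Q}

/-- The Duhamel symbol is continuous in `ξ` (for continuous forcing). [folklore] -/
theorem continuous_duhamelSymbolFn (hQ : Continuous Q) (t : ℝ) : Continuous (duhamelSymbolFn Q t) :=
  intervalIntegral.continuous_parametric_intervalIntegral_of_continuous'
    (f := fun (ξ : EuclideanSpace ℝ (Fin 3)) (s : ℝ) => Q s * heatSymbol (t - s) ξ)
    ((hQ.comp continuous_snd).mul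
      (continuous_heatSymbol₂.comp ((continuous_const.sub continuous_snd).prodMk continuous_fst))) 0 t

/-- A continuous forcing is bounded on `[0, t]`. [folklore] -/
theorem exists_bound_uIoc (hQ : Continuous Q) (t : ℝ) :
    ∃ C : ℝ, 0 ≤ C ∧ ∀ s ∈ Set.uIoc (0 : ℝ) t, ‖Q s‖ ≤ C := by
  obtain ⟨C, hC⟩ := (isCompact_uIcc (a := (0 : ℝ)) (b := t)).exists_bound_of_continuousOn
    (f := Q) (hQ.continuousOn)
  exact ⟨max C 0, le_max_right _ _, fun s hs => (hC s (uIoc_subset_uIcc hs)).trans (le_max_left _ _)⟩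

/-- The Duhamel symbol is bounded: `|M_t(ξ)| ≤ (sup_{[0,t]} |Q|) |t|`. [folklore] -/
theorem norm_duhamelSymbolFn_le {t C : ℝ} (hC : ∀ s ∈ Set.uIoc (0 : ℝ) t, ‖Q s‖ ≤ C) (hC0 : 0 ≤ C)
    (ξ : EuclideanSpace ℝ (Fin 3)) : ‖duhamelSymbolFn Q t ξ‖ ≤ C * |t| := by
  have h := intervalIntegral.norm_integral_le_of_norm_le_const (a := 0) (b := t) (C := C)
    (f := fun s => Q s * heatSymbol (t - s) ξ) fun s hs => by
      rw [norm_mul, ← mul_one C]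
      exact mul_le_mul (hC s hs) (norm_heatSymbol_le _ _) (norm_nonneg _) hC0
  simpa [sub_zero, duhamelSymbolFn] using h

/-- The Duhamel symbol is an `L^∞` symbol (continuous and bounded). [folklore] -/
theorem memLp_top_duhamelSymbolFn (hQ : Continuous Q) (t : ℝ) :
    MemLp (duhamelSymbolFn Q t) ∞ (volume : Measure (EuclideanSpace ℝ (Fin 3))) := by
  obtain ⟨C, hC0, hC⟩ := exists_bound_uIoc hQ t
  exact memLp_top_of_bound (continuous_duhamelSymbolFn hQ t).aestronglyMeasurable (C * |t|)
    (Eventually.of_forall (norm_duhamelSymbolFn_le hC hC0))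

variable (Q) in
/-- The Duhamel symbol as an element of `L^∞`, so that `M_t(D)` is the accepted
`fourierMultiplier` (junk `0` if the symbol is not essentially bounded, which does not happen for
continuous forcing, `duhamelSymbol_eq`). [cite: Tao2016AveragedNS, Lemma 4.1 (4.14)] -/
def duhamelSymbol (t : ℝ) : Lp ℂ ∞ (volume : Measure (EuclideanSpace ℝ (Fin 3))) := by
  classical
  exact if h : MemLp (duhamelSymbolFn Q t) ∞ (volume : Measure (EuclideanSpace ℝ (Fin 3))) then h.toLp _
    else 0

/-- For continuous forcing the Duhamel symbol is the `L^∞` class of `M_t`. [folklore] -/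
theorem duhamelSymbol_eq (hQ : Continuous Q) (t : ℝ) :
    duhamelSymbol Q t = (memLp_top_duhamelSymbolFn hQ t).toLp _ := by
  unfold duhamelSymbol
  rw [dif_pos (memLp_top_duhamelSymbolFn hQ t)]

/-- A representative of the Duhamel symbol. [folklore] -/
theorem coeFn_duhamelSymbol (hQ : Continuous Q) (t : ℝ) :
    ((duhamelSymbol Q t : Lp ℂ ∞ volume) : EuclideanSpace ℝ (Fin 3) → ℂ) =ᵐ[volume] duhamelSymbolFn Q t := by
  rw [duhamelSymbol_eq hQ]
  exact MemLp.coeFn_toLp _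

/-- **Fubini for the Duhamel term**: pairing the multiplier `M_t(D)v` against `w` is the time
integral of the pairings of the heat-flowed field,
`⟨M_t(D) v, w⟩ = ∫₀ᵗ Q(s) ⟨e^{(t-s)Δ} v, w⟩ ds` (the integrand `Q(s) e^{-4π²(t-s)|ξ|²} (v̂(ξ)·ŵ(-ξ))`
is bounded by `(sup|Q|) |v̂(ξ)·ŵ(-ξ)|`, integrable on `[0,t] × ℝ³`). This is the sense in which
`M_t(D)ψ = ∫₀ᵗ Q(s) e^{(t-s)Δ} ψ ds` in the display after (4.14). [cite: Tao2016AveragedNS, Lemma 4.1 (4.14)] -/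
theorem pairing_fourierMultiplier_duhamelSymbol (hQ : Continuous Q) {t : ℝ} (ht : 0 ≤ t) (v w : L2C) :
    pairing (fourierMultiplier (duhamelSymbol Q t) v) w =
      ∫ s in (0 : ℝ)..t, Q s * pairing (heat (t - s) v) w := by
  set c : EuclideanSpace ℝ (Fin 3) → ℂ := fun ξ => cdot (fourierFn v ξ) (fourierFn w (-ξ)) with hc
  have hc_int : Integrable c := integrable_cdot_fourierFn v w
  have hL : pairing (fourierMultiplier (duhamelSymbol Q t) v) w = ∫ ξ, duhamelSymbolFn Q t ξ * c ξ := by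
    rw [pairing_fourierMultiplier_eq_integral]
    refine integral_congr_ae ?_
    filter_upwards [coeFn_duhamelSymbol hQ t] with ξ hξ
    rw [hξ]
  have hR : ∀ s, Q s * pairing (heat (t - s) v) w = ∫ ξ, Q s * heatSymbol (t - s) ξ * c ξ := fun s => by
    rw [pairing_heat_eq_integral, ← integral_const_mul]
    exact integral_congr_ae (Eventually.of_forall fun ξ => by simp only [hc]; ring)
  rw [hL]
  simp_rw [hR]
  rw [intervalIntegral.integral_of_le ht]
  -- Fubini on `[0,t] × ℝ³`
  obtain ⟨C, hC0, hC⟩ := exists_bound_uIoc hQ t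
  have hF : Integrable (Function.uncurry fun (s : ℝ) (ξ : EuclideanSpace ℝ (Fin 3)) =>
      Q s * heatSymbol (t - s) ξ * c ξ) ((volume.restrict (Ioc 0 t)).prod volume) := by
    have hg : Integrable (fun z : ℝ × EuclideanSpace ℝ (Fin 3) => ((C : ℝ) : ℂ) * (‖c z.2‖ : ℂ))
        ((volume.restrict (Ioc 0 t)).prod volume) := by
      refine Integrable.mul_prod (f := fun _ : ℝ => ((C : ℝ) : ℂ)) (g := fun ξ => ((‖c ξ‖ : ℝ) : ℂ)) ?_ ?_
      · exact integrableOn_const (measure_Ioc_lt_top.ne)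
      · exact hc_int.norm.ofReal
    have hmeas : AEStronglyMeasurable (Function.uncurry fun (s : ℝ) (ξ : EuclideanSpace ℝ (Fin 3)) =>
        Q s * heatSymbol (t - s) ξ * c ξ) ((volume.restrict (Ioc 0 t)).prod volume) := by
      refine (((hQ.comp continuous_fst).mul (continuous_heatSymbol₂.comp
        ((continuous_const.sub continuous_fst).prodMk continuous_snd))).aestronglyMeasurable).mul
        hc_int.aestronglyMeasurable.comp_snd
    refine hg.norm.mono' hmeas ?_
    have hS : ∀ᵐ z ∂((volume.restrict (Ioc 0 t)).prod (volume : Measure (EuclideanSpace ℝ (Fin 3)))),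
        z.1 ∈ Ioc 0 t :=
      (Measure.quasiMeasurePreserving_fst (μ := volume.restrict (Ioc 0 t))
        (ν := (volume : Measure (EuclideanSpace ℝ (Fin 3))))).ae (ae_restrict_mem measurableSet_Ioc)
    filter_upwards [hS] with z hz
    obtain ⟨s, ξ⟩ := z
    simp only [Function.uncurry_apply_pair, norm_mul, Complex.norm_real, Real.norm_eq_abs,
      abs_of_nonneg hC0, abs_norm]
    have h1 : ‖Q s‖ ≤ C := hC s (by rwa [uIoc_of_le ht])
    have h2 : ‖heatSymbol (t - s) ξ‖ ≤ 1 := norm_heatSymbol_le _ _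
    calc ‖Q s‖ * ‖heatSymbol (t - s) ξ‖ * ‖c ξ‖ ≤ C * 1 * ‖c ξ‖ := by
          gcongr
      _ = C * ‖c ξ‖ := by ring
  rw [MeasureTheory.integral_integral_swap hF]
  refine integral_congr_ae (Eventually.of_forall fun ξ => ?_)
  simp only
  rw [MeasureTheory.integral_mul_const, duhamelSymbolFn, intervalIntegral.integral_of_le ht]

end DuhamelField

/-! ## Part VI: the Duhamel field of a mode and the identification `u_{i,n}(t) = m_t(D) ψ_{i,n}` -/

section GenericMultiplier

/-- **Conjugation and Fourier multipliers with real even symbols**: if `\overline{m(ξ)} = m(ξ)`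
and `m(-ξ) = m(ξ)` then `\overline{m(D) v} = m(D) \overline{v}` (so `m(D)` preserves
realness; Tao's "real Fourier multipliers", p. 6). [folklore] -/
theorem conjL2_fourierMultiplier_of_real_even {mf : EuclideanSpace ℝ (Fin 3) → ℂ}
    (hmf : MemLp mf ∞ (volume : Measure (EuclideanSpace ℝ (Fin 3))))
    (hreal : ∀ ξ, conj (mf ξ) = mf ξ) (heven : ∀ ξ, mf (-ξ) = mf ξ) (v : L2C) :
    conjL2 (fourierMultiplier (hmf.toLp _) v) = fourierMultiplier (hmf.toLp _) (conjL2 v) := by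
  apply eq_of_fourierFn_ae_eq
  have hq : Measure.QuasiMeasurePreserving (fun x : EuclideanSpace ℝ (Fin 3) => -x) volume volume :=
    (Measure.measurePreserving_neg (volume : Measure (EuclideanSpace ℝ (Fin 3)))).quasiMeasurePreserving
  filter_upwards [fourierFn_conjL2 (fourierMultiplier (hmf.toLp _) v),
    hq.ae_eq (fourierFn_fourierMultiplier (hmf.toLp _) v), hq.ae_eq (MemLp.coeFn_toLp hmf),
    fourierFn_fourierMultiplier (hmf.toLp _) (conjL2 v), MemLp.coeFn_toLp hmf, fourierFn_conjL2 v]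
    with ξ h1 h2 h3 h4 h5 h6
  rw [h1, h4, h5, h6,
    show fourierFn (fourierMultiplier (hmf.toLp mf) v) (-ξ) =
      ((hmf.toLp mf : Lp ℂ ∞ volume) : EuclideanSpace ℝ (Fin 3) → ℂ) (-ξ) • fourierFn v (-ξ) from h2,
    show ((hmf.toLp mf : Lp ℂ ∞ volume) : EuclideanSpace ℝ (Fin 3) → ℂ) (-ξ) = mf (-ξ) from h3,
    conj3_smul, heven, hreal]

end GenericMultiplier

section ModeField

variable {ε₀ : ℝ} {m : ℕ} (𝒟 : CascadeWaveletData ε₀ m)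
  (α : Fin m → Fin m → Fin m → ℤ × ℤ × ℤ → ℝ) (u : ℝ → L2C) (i : Fin m) (n : ℤ)

/-- The **forcing of the mode `(i,n)`** along the curve `u`: `Q_{i,n}(s) = quadTerm_{i,n}(u(s))`
(the complex form, `quadTermC`), extended to negative times by its value at `0` (values at
`s < 0` are never integrated over; the extension makes `Q_{i,n}` continuous on all of `ℝ` for an
`H¹⁰`-continuous curve on `[0,+∞)`). [cite: Tao2016AveragedNS, Lemma 4.1 (4.14)] -/
def modeForcing (s : ℝ) : ℂ :=
  quadTermC ε₀ 𝒟.ψ α (u (max s 0)) i n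

variable {𝒟 α u i n}

/-- At nonnegative times the mode forcing is `quadTerm_{i,n}(u(s))`. [folklore] -/
theorem modeForcing_of_nonneg {s : ℝ} (hs : 0 ≤ s) : modeForcing 𝒟 α u i n s = quadTermC ε₀ 𝒟.ψ α (u s) i n := by
  rw [modeForcing, max_eq_left hs]

/-- The complex quadratic term is continuous along an `L²`-continuous curve. [folklore] -/
theorem continuousOn_quadTermC {I : Set ℝ} (hu : ContinuousOn u I) (i : Fin m) (n : ℤ) :
    ContinuousOn (fun s => quadTermC ε₀ 𝒟.ψ α (u s) i n) I := by
  unfold quadTermC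
  refine continuousOn_finsetSum _ fun i₁ _ => continuousOn_finsetSum _ fun i₂ _ =>
    continuousOn_finsetSum _ fun μ _ => ?_
  exact (continuousOn_const.mul ((ContinuousOn.pairing_left hu _).mul (ContinuousOn.pairing_left hu _)))

/-- **The mode forcing of an `H¹⁰`-continuous curve on `[0,+∞)` is continuous on `ℝ`.** [folklore] -/
theorem continuous_modeForcing (hu : ContinuousInH10On (Ici 0) u) : Continuous (modeForcing 𝒟 α u i n) := by
  exact (continuousOn_quadTermC (𝒟 := 𝒟) (α := α) hu.continuousOn i n).comp_continuous
    (continuous_id.max continuous_const) fun s => mem_Ici.2 (le_max_right _ _)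

/-- On a real curve the mode forcing is real: `Q_{i,n}(s) = quadTerm_{i,n}(X(max(s,0)))` with the
real coefficients `X = modeCoeff`. [folklore] -/
theorem modeForcing_eq_ofReal (hreal : ∀ s, 0 ≤ s → IsReal (u s)) (s : ℝ) :
    modeForcing 𝒟 α u i n s =
      ((TaoCascade.quadTerm ε₀ α (modeCoeff 𝒟 u) i n (max s 0) : ℝ) : ℂ) := by
  rw [modeForcing, quadTermC_eq_ofReal (hreal _ (le_max_right _ _))]
  rfl

/-- The mode forcing of a real curve is conjugation invariant. [folklore] -/
theorem conj_modeForcing (hreal : ∀ s, 0 ≤ s → IsReal (u s)) (s : ℝ) :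
    conj (modeForcing 𝒟 α u i n s) = modeForcing 𝒟 α u i n s := by
  rw [modeForcing_eq_ofReal hreal, Complex.conj_ofReal]

/-- The indicator `1_{(i,n) = (i₀,n₀)}` as a real number. [folklore] -/
def modeDelta (i₀ i : Fin m) (n₀ n : ℤ) : ℝ := if i₀ = i ∧ n₀ = n then 1 else 0

/-- **The Duhamel field of the mode `(i,n)`**:
`F_{i,n}(t) = 1_{(i,n)=(i₀,n₀)} e^{tΔ} ψ_{i,n} + M_t(D) ψ_{i,n}`, `M_t(ξ) = ∫₀ᵗ Q_{i,n}(s) e^{-4π²(t-s)|ξ|²} ds`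
— the right-hand side of the display after (4.14),
`u_{i,n}(t) = e^{tΔ} X_{i,n}(0) ψ_{i,n} + ∫₀ᵗ [quadTerm](t') e^{(t-t')Δ} ψ_{i,n} dt'`, as an honest
element of `L²` (a Fourier multiplier applied to `ψ_{i,n}`). [cite: Tao2016AveragedNS, Lemma 4.1 (4.14)] -/
def duhamelModeField (𝒟 : CascadeWaveletData ε₀ m) (α : Fin m → Fin m → Fin m → ℤ × ℤ × ℤ → ℝ)
    (u : ℝ → L2C) (i : Fin m) (n : ℤ) (i₀ : Fin m) (n₀ : ℤ) (t : ℝ) : L2C :=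
  ((modeDelta i₀ i n₀ n : ℝ) : ℂ) • heat t (cascadeWavelet ε₀ (𝒟.ψ i) n) +
    fourierMultiplier (duhamelSymbol (modeForcing 𝒟 α u i n) t) (cascadeWavelet ε₀ (𝒟.ψ i) n)

end ModeField

section ModeFieldProps

variable {ε₀ : ℝ} {m : ℕ} {𝒟 : CascadeWaveletData ε₀ m}
  {α : Fin m → Fin m → Fin m → ℤ × ℤ × ℤ → ℝ} {u : ℝ → L2C} {i₀ i : Fin m} {n₀ n : ℤ}

/-- Conjugation is conjugate-linear. [folklore] -/
theorem conjL2_smul (c : ℂ) (v : L2C) : conjL2 (c • v) = conj c • conjL2 v := by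
  apply Lp.ext
  filter_upwards [coeFn_conjL2 (c • v), Lp.coeFn_smul c v, Lp.coeFn_smul (conj c) (conjL2 v),
    coeFn_conjL2 v] with x h1 h2 h3 h4
  rw [h1, h2, h3, Pi.smul_apply, Pi.smul_apply, h4, conj3_smul]

/-- The Duhamel symbol of a conjugation-invariant forcing is conjugation invariant. [folklore] -/
theorem conj_duhamelSymbolFn {Q : ℝ → ℂ} (hQ : ∀ s, conj (Q s) = Q s) {t : ℝ} (ht : 0 ≤ t)
    (ξ : EuclideanSpace ℝ (Fin 3)) : conj (duhamelSymbolFn Q t ξ) = duhamelSymbolFn Q t ξ := by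
  rw [duhamelSymbolFn, intervalIntegral.integral_of_le ht, ← integral_conj]
  refine integral_congr_ae (Eventually.of_forall fun s => ?_)
  simp only [map_mul, hQ, conj_heatSymbol]

/-- The Duhamel symbol is even in `ξ`. [folklore] -/
theorem duhamelSymbolFn_neg (Q : ℝ → ℂ) (t : ℝ) (ξ : EuclideanSpace ℝ (Fin 3)) :
    duhamelSymbolFn Q t (-ξ) = duhamelSymbolFn Q t ξ := by
  simp only [duhamelSymbolFn, heatSymbol_neg]

/-- **The pairings of the Duhamel field**:
`⟨F_{i,n}(t), w⟩ = 1_{(i,n)=(i₀,n₀)} ⟨e^{tΔ}ψ_{i,n}, w⟩ + ∫₀ᵗ Q_{i,n}(s) ⟨e^{(t-s)Δ}ψ_{i,n}, w⟩ ds`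
(linearity and the Fubini lemma `pairing_fourierMultiplier_duhamelSymbol`). [cite: Tao2016AveragedNS, Lemma 4.1 (4.14)] -/
theorem pairing_duhamelModeField (hu : ContinuousInH10On (Ici 0) u) {t : ℝ} (ht : 0 ≤ t) (w : L2C) :
    pairing (duhamelModeField 𝒟 α u i n i₀ n₀ t) w =
      ((modeDelta i₀ i n₀ n : ℝ) : ℂ) * pairing (heat t (cascadeWavelet ε₀ (𝒟.ψ i) n)) w +
        ∫ s in (0 : ℝ)..t, modeForcing 𝒟 α u i n s *
          pairing (heat (t - s) (cascadeWavelet ε₀ (𝒟.ψ i) n)) w := by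
  rw [duhamelModeField, pairing_add_left, pairing_smul_left,
    pairing_fourierMultiplier_duhamelSymbol (continuous_modeForcing hu) ht]

/-- **The projected mild solution and the Duhamel field have the same pairings against
`H¹⁰_df`**: for `t ≥ 0` and `w ∈ H¹⁰_df`, `⟨P_{i,n} u(t), w⟩ = ⟨F_{i,n}(t), w⟩`. [cite: Tao2016AveragedNS, Lemma 4.1 (4.14)] -/
theorem pairing_modeProjection_eq_pairing_duhamelModeField (hε : 0 < ε₀)
    (hu : IsMildSolutionFor (cascadeOperatorForm ε₀ 𝒟.ψ α) (cascadeWavelet ε₀ (𝒟.ψ i₀) n₀) (Ici 0) u)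
    {t : ℝ} (ht : 0 ≤ t) {w : L2C} (hw : MemH10df w) :
    pairing (modeProjection 𝒟 i n (u t)) w = pairing (duhamelModeField 𝒟 α u i n i₀ n₀ t) w := by
  rw [pairing_modeProjection_eq_of_isMildSolutionFor hε hu i n ht hw, pairing_duhamelModeField hu.2.1 ht]
  congr 1
  · simp only [modeDelta]
    split_ifs <;> simp
  · refine intervalIntegral.integral_congr fun s hs => ?_
    rw [uIcc_of_le ht] at hs
    show _ = modeForcing 𝒟 α u i n s * _
    rw [modeForcing_of_nonneg hs.1]

/-- The Duhamel field is band-limited to the region of its mode. [folklore] -/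
theorem isBandLimited_duhamelModeField (hε : 0 < 1 + ε₀) (t : ℝ) :
    IsBandLimited (freqRegion 𝒟 i n) (duhamelModeField 𝒟 α u i n i₀ n₀ t) :=
  (((isBandLimited_cascadeWavelet hε i n).heat t).smul _).add
    ((isBandLimited_cascadeWavelet hε i n).fourierMultiplier _)

/-- **The Duhamel field lies in `H¹⁰_df`** (finite `H¹⁰` norm: bounded multipliers of the `H¹⁰`
field `ψ_{i,n}`; divergence free: scalar symbols; real: the symbols `e^{-4π²t|ξ|²}` and `M_t(ξ)`
are real and even and the forcing of a real curve is real). [cite: Tao2016AveragedNS, Lemma 4.1 (4.14)] -/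
theorem memH10df_duhamelModeField (hε : 0 < ε₀) (hu : ContinuousInH10On (Ici 0) u)
    (hreal : ∀ s, 0 ≤ s → IsReal (u s)) {t : ℝ} (ht : 0 ≤ t) :
    MemH10df (duhamelModeField 𝒟 α u i n i₀ n₀ t) := by
  have hε' : 0 < 1 + ε₀ := by linarith
  have hψ : MemH10df (cascadeWavelet ε₀ (𝒟.ψ i) n) := 𝒟.memH10df_cascadeWavelet hε' i n
  have hQ : Continuous (modeForcing 𝒟 α u i n) := continuous_modeForcing hu
  refine MemH10df.add ((hψ.heat t).smul _) ⟨?_, ?_, hψ.2.2.fourierMultiplier _⟩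
  · -- finite `H¹⁰` norm (`‖m(D)ψ‖_{H¹⁰} ≤ ‖m‖_∞ ‖ψ‖_{H¹⁰}`, tree `eFourierSobolevNorm_fourierMultiplier_le`)
    exact (eFourierSobolevNorm_fourierMultiplier_le 10 _ _).trans_lt (ENNReal.mul_lt_top enorm_lt_top hψ.1)
  · -- real
    rw [isReal_iff_conjL2_eq, duhamelSymbol_eq hQ,
      conjL2_fourierMultiplier_of_real_even (memLp_top_duhamelSymbolFn hQ t)
        (conj_duhamelSymbolFn (conj_modeForcing hreal) ht) (duhamelSymbolFn_neg _ t),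
      (isReal_iff_conjL2_eq _).1 hψ.2.1]

/-- **The identification `u_{i,n}(t) = F_{i,n}(t)`** (Tao, p. 22, the display after (4.14)): for a
global mild solution with datum `ψ_{i₀,n₀}` and `t ≥ 0`,
`P_{i,n} u(t) = 1_{(i,n)=(i₀,n₀)} e^{tΔ} ψ_{i,n} + M_t(D) ψ_{i,n}`.
Both sides lie in `H¹⁰_df` and have the same pairings against `H¹⁰_df`
(`pairing_modeProjection_eq_pairing_duhamelModeField`); testing against their difference `w`,
`⟨w, w⟩ = 0`, so `w = 0` (`eq_zero_of_pairing_self_eq_zero`). [cite: Tao2016AveragedNS, Lemma 4.1 (4.14)] -/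
theorem modeProjection_eq_duhamelModeField (hε : 0 < ε₀)
    (hu : IsMildSolutionFor (cascadeOperatorForm ε₀ 𝒟.ψ α) (cascadeWavelet ε₀ (𝒟.ψ i₀) n₀) (Ici 0) u)
    {t : ℝ} (ht : 0 ≤ t) :
    modeProjection 𝒟 i n (u t) = duhamelModeField 𝒟 α u i n i₀ n₀ t := by
  have hP : MemH10df (modeProjection 𝒟 i n (u t)) := (hu.1 t ht).modeProjection 𝒟 i n
  have hF : MemH10df (duhamelModeField 𝒟 α u i n i₀ n₀ t) :=
    memH10df_duhamelModeField hε hu.2.1 (fun s hs => (hu.1 s hs).2.1) ht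
  have hw : MemH10df (modeProjection 𝒟 i n (u t) - duhamelModeField 𝒟 α u i n i₀ n₀ t) := hP.sub hF
  have h0 : pairing (modeProjection 𝒟 i n (u t) - duhamelModeField 𝒟 α u i n i₀ n₀ t)
      (modeProjection 𝒟 i n (u t) - duhamelModeField 𝒟 α u i n i₀ n₀ t) = 0 := by
    rw [pairing_sub_left, pairing_modeProjection_eq_pairing_duhamelModeField hε hu ht hw, sub_self]
  exact sub_eq_zero.1 (eq_zero_of_pairing_self_eq_zero hw.2.1 h0)

end ModeFieldProps

/-! ## Part VII: the coefficient and the energy of a mode as frequency integrals -/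

section Formulas

variable {ε₀ : ℝ} {m : ℕ} {𝒟 : CascadeWaveletData ε₀ m}
  {α : Fin m → Fin m → Fin m → ℤ × ℤ × ℤ → ℝ} {u : ℝ → L2C} {i₀ i : Fin m} {n₀ n : ℤ}

/-- `a · ā = ‖a‖²`. [folklore] -/
theorem cdot_conj3_self (a : EuclideanSpace ℂ (Fin 3)) : cdot a (conj3 a) = ((‖a‖ ^ 2 : ℝ) : ℂ) := by
  rw [EuclideanSpace.norm_sq_eq, Complex.ofReal_sum]
  simp only [cdot, conj3_apply, Complex.mul_conj, Complex.normSq_eq_norm_sq, Complex.ofReal_pow]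

/-- For a **real** field, `ψ̂(-ξ) = \overline{ψ̂(ξ)}` a.e. [folklore] -/
theorem fourierFn_neg_eq_conj3 {ψ : L2C} (hψ : IsReal ψ) :
    ∀ᵐ ξ ∂(volume : Measure (EuclideanSpace ℝ (Fin 3))), fourierFn ψ (-ξ) = conj3 (fourierFn ψ ξ) := by
  have hq : Measure.QuasiMeasurePreserving (fun x : EuclideanSpace ℝ (Fin 3) => -x) volume volume :=
    (Measure.measurePreserving_neg (volume : Measure (EuclideanSpace ℝ (Fin 3)))).quasiMeasurePreserving
  have h := fourierFn_conjL2 ψ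
  rw [(isReal_iff_conjL2_eq ψ).1 hψ] at h
  filter_upwards [hq.ae_eq h] with ξ hξ
  simpa using hξ

/-- The full symbol of the mode: `m_t(ξ) = 1_{(i,n)=(i₀,n₀)} e^{-4π²t|ξ|²} + M_t(ξ)`. [cite: Tao2016AveragedNS, Lemma 4.1 (4.14)] -/
def modeSymbol (𝒟 : CascadeWaveletData ε₀ m) (α : Fin m → Fin m → Fin m → ℤ × ℤ × ℤ → ℝ)
    (u : ℝ → L2C) (i : Fin m) (n : ℤ) (i₀ : Fin m) (n₀ : ℤ) (t : ℝ) (ξ : EuclideanSpace ℝ (Fin 3)) : ℂ :=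
  ((modeDelta i₀ i n₀ n : ℝ) : ℂ) * heatSymbol t ξ + duhamelSymbolFn (modeForcing 𝒟 α u i n) t ξ

/-- **The Fourier transform of the Duhamel field**: `\widehat{F_{i,n}(t)} = m_t ψ̂_{i,n}` a.e. [cite: Tao2016AveragedNS, Lemma 4.1 (4.14)] -/
theorem fourierFn_duhamelModeField (hu : ContinuousInH10On (Ici 0) u) (t : ℝ) :
    fourierFn (duhamelModeField 𝒟 α u i n i₀ n₀ t) =ᵐ[volume] fun ξ =>
      modeSymbol 𝒟 α u i n i₀ n₀ t ξ • fourierFn (cascadeWavelet ε₀ (𝒟.ψ i) n) ξ := by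
  have hQ : Continuous (modeForcing 𝒟 α u i n) := continuous_modeForcing hu
  unfold duhamelModeField
  filter_upwards [fourierFn_add (((modeDelta i₀ i n₀ n : ℝ) : ℂ) • heat t (cascadeWavelet ε₀ (𝒟.ψ i) n))
      (fourierMultiplier (duhamelSymbol (modeForcing 𝒟 α u i n) t) (cascadeWavelet ε₀ (𝒟.ψ i) n)),
    fourierFn_smul (((modeDelta i₀ i n₀ n : ℝ) : ℂ)) (heat t (cascadeWavelet ε₀ (𝒟.ψ i) n)),
    fourierFn_heat t (cascadeWavelet ε₀ (𝒟.ψ i) n),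
    fourierFn_fourierMultiplier (duhamelSymbol (modeForcing 𝒟 α u i n) t) (cascadeWavelet ε₀ (𝒟.ψ i) n),
    coeFn_duhamelSymbol hQ t] with ξ h1 h2 h3 h4 h5
  rw [h1, h2, h3, h4, h5, modeSymbol, add_smul, smul_smul]

/-- The symbol of a real curve is real. [folklore] -/
theorem conj_modeSymbol (hreal : ∀ s, 0 ≤ s → IsReal (u s)) {t : ℝ} (ht : 0 ≤ t)
    (ξ : EuclideanSpace ℝ (Fin 3)) : conj (modeSymbol 𝒟 α u i n i₀ n₀ t ξ) = modeSymbol 𝒟 α u i n i₀ n₀ t ξ := by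
  rw [modeSymbol, map_add, map_mul, Complex.conj_ofReal, conj_heatSymbol,
    conj_duhamelSymbolFn (conj_modeForcing hreal) ht]

/-- The symbol of a real curve equals its real part. [folklore] -/
theorem modeSymbol_eq_ofReal_re (hreal : ∀ s, 0 ≤ s → IsReal (u s)) {t : ℝ} (ht : 0 ≤ t)
    (ξ : EuclideanSpace ℝ (Fin 3)) :
    modeSymbol 𝒟 α u i n i₀ n₀ t ξ = (((modeSymbol 𝒟 α u i n i₀ n₀ t ξ).re : ℝ) : ℂ) :=
  eq_ofReal_re_of_im_eq_zero (Complex.conj_eq_iff_im.1 (conj_modeSymbol hreal ht ξ))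

/-- **The coefficient as a frequency integral**: for a global mild solution and `t ≥ 0`,
`X_{i,n}(t) = ∫ Re m_t(ξ) |ψ̂_{i,n}(ξ)|² dξ` (`X_{i,n} = ⟨u, ψ_{i,n}⟩ = ⟨u_{i,n}, ψ_{i,n}⟩ = ⟨F_{i,n}, ψ_{i,n}⟩`
and Parseval). [cite: Tao2016AveragedNS, Lemma 4.1 (4.14)] -/
theorem modeCoeff_eq_integral (hε : 0 < ε₀)
    (hu : IsMildSolutionFor (cascadeOperatorForm ε₀ 𝒟.ψ α) (cascadeWavelet ε₀ (𝒟.ψ i₀) n₀) (Ici 0) u)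
    {t : ℝ} (ht : 0 ≤ t) :
    modeCoeff 𝒟 u i n t =
      ∫ ξ, (modeSymbol 𝒟 α u i n i₀ n₀ t ξ).re * ‖fourierFn (cascadeWavelet ε₀ (𝒟.ψ i) n) ξ‖ ^ 2 := by
  have hreal : ∀ s, 0 ≤ s → IsReal (u s) := fun s hs => (hu.1 s hs).2.1
  have hψreal : IsReal (cascadeWavelet ε₀ (𝒟.ψ i) n) := isReal_cascadeWavelet ε₀ (𝒟.ψ i) n
  have h1 : pairing (u t) (cascadeWavelet ε₀ (𝒟.ψ i) n) =
      pairing (duhamelModeField 𝒟 α u i n i₀ n₀ t) (cascadeWavelet ε₀ (𝒟.ψ i) n) := by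
    rw [← modeProjection_eq_duhamelModeField hε hu ht, pairing_modeProjection_left,
      modeProjection_cascadeWavelet hε, if_pos ⟨rfl, rfl⟩]
  have h2 : pairing (duhamelModeField 𝒟 α u i n i₀ n₀ t) (cascadeWavelet ε₀ (𝒟.ψ i) n) =
      ∫ ξ, (((modeSymbol 𝒟 α u i n i₀ n₀ t ξ).re * ‖fourierFn (cascadeWavelet ε₀ (𝒟.ψ i) n) ξ‖ ^ 2 : ℝ) : ℂ) := by
    rw [pairing_eq_integral_cdot_fourierFn]
    refine integral_congr_ae ?_
    filter_upwards [fourierFn_duhamelModeField hu.2.1 t, fourierFn_neg_eq_conj3 hψreal] with ξ h3 h4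
    have hleft : ∀ (c : ℂ) (a b : EuclideanSpace ℂ (Fin 3)), cdot (c • a) b = c * cdot a b :=
      fun c a b => by simp [cdot, Finset.mul_sum, mul_assoc]
    rw [h3, h4, hleft, cdot_conj3_self]
    conv_lhs => rw [modeSymbol_eq_ofReal_re hreal ht ξ]
    push_cast
    ring
  rw [modeCoeff, h1, h2, integral_complex_ofReal, Complex.ofReal_re]

/-- **The local energy as a frequency integral**: for a global mild solution and `t ≥ 0`,
`E_{i,n}(t) = ½ ∫ (Re m_t(ξ))² |ψ̂_{i,n}(ξ)|² dξ` (`E_{i,n} = ½‖u_{i,n}‖² = ½‖F_{i,n}‖²` and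
Plancherel). [cite: Tao2016AveragedNS, Lemma 4.1 (4.5)] -/
theorem modeEnergy_eq_integral (hε : 0 < ε₀)
    (hu : IsMildSolutionFor (cascadeOperatorForm ε₀ 𝒟.ψ α) (cascadeWavelet ε₀ (𝒟.ψ i₀) n₀) (Ici 0) u)
    {t : ℝ} (ht : 0 ≤ t) :
    modeEnergy 𝒟 u i n t =
      (∫ ξ, (modeSymbol 𝒟 α u i n i₀ n₀ t ξ).re ^ 2 * ‖fourierFn (cascadeWavelet ε₀ (𝒟.ψ i) n) ξ‖ ^ 2) / 2 := by
  have hreal : ∀ s, 0 ≤ s → IsReal (u s) := fun s hs => (hu.1 s hs).2.1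
  rw [modeEnergy, modeProjection_eq_duhamelModeField hε hu ht, norm_sq_eq_integral_fourierFn]
  congr 1
  refine integral_congr_ae ?_
  filter_upwards [fourierFn_duhamelModeField hu.2.1 t] with ξ hξ
  rw [hξ, norm_smul, mul_pow]
  conv_lhs => rw [modeSymbol_eq_ofReal_re hreal ht ξ, Complex.norm_real, Real.norm_eq_abs, sq_abs]

end Formulas


/-! ## Part VIII: the scalar Duhamel function and differentiation under the frequency integral -/

section Scalar

variable (δ : ℝ) (Qr : ℝ → ℝ)

/-- The **scalar Duhamel function** `φ_L(t) = e^{-Lt} (δ + ∫₀ᵗ Qr(s) e^{Ls} ds)`, the solution of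
`φ' = -L φ + Qr`, `φ(0) = δ` (`L = 4π²|ξ|²` gives `Re m_t(ξ)` for `t ≥ 0`). [cite: Tao2016AveragedNS, Lemma 4.1 (4.14)] -/
def duhamelScalar (L t : ℝ) : ℝ :=
  Real.exp (-(L * t)) * (δ + ∫ s in (0 : ℝ)..t, Qr s * Real.exp (L * s))

variable {δ Qr}

/-- `φ_L(0) = δ`. [folklore] -/
theorem duhamelScalar_zero (L : ℝ) : duhamelScalar δ Qr L 0 = δ := by
  simp [duhamelScalar]

/-- **`φ_L' = -L φ_L + Qr`** (product rule and the fundamental theorem of calculus). [folklore] -/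
theorem hasDerivAt_duhamelScalar (hQ : Continuous Qr) (L t : ℝ) :
    HasDerivAt (duhamelScalar δ Qr L) (-L * duhamelScalar δ Qr L t + Qr t) t := by
  have hg : Continuous fun s => Qr s * Real.exp (L * s) := hQ.mul (Real.continuous_exp.comp (continuous_const.mul continuous_id))
  have h1 : HasDerivAt (fun t => Real.exp (-(L * t))) (-L * Real.exp (-(L * t))) t := by
    have := ((hasDerivAt_id t).const_mul L).neg.exp
    simpa [mul_comm] using this
  have h2 : HasDerivAt (fun t => δ + ∫ s in (0 : ℝ)..t, Qr s * Real.exp (L * s))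
      (Qr t * Real.exp (L * t)) t :=
    (intervalIntegral.integral_hasDerivAt_right (hg.intervalIntegrable _ _)
      (hg.stronglyMeasurableAtFilter _ _) hg.continuousAt).const_add δ
  have h := h1.mul h2
  refine h.congr_deriv ?_
  simp only [duhamelScalar]
  rw [show -L * Real.exp (-(L * t)) * (δ + ∫ s in (0 : ℝ)..t, Qr s * Real.exp (L * s)) +
      Real.exp (-(L * t)) * (Qr t * Real.exp (L * t)) =
      -L * (Real.exp (-(L * t)) * (δ + ∫ s in (0 : ℝ)..t, Qr s * Real.exp (L * s))) +
        Qr t * (Real.exp (-(L * t)) * Real.exp (L * t)) by ring, ← Real.exp_add]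
  simp

/-- The scalar Duhamel function is jointly continuous in `(L, t)`. [folklore] -/
theorem continuous_duhamelScalar₂ (hQ : Continuous Qr) :
    Continuous fun p : ℝ × ℝ => duhamelScalar δ Qr p.1 p.2 := by
  unfold duhamelScalar
  refine ((Real.continuous_exp.comp (continuous_fst.mul continuous_snd).neg)).mul
    (continuous_const.add ?_)
  exact intervalIntegral.continuous_parametric_intervalIntegral_of_continuous
    (f := fun (p : ℝ × ℝ) (s : ℝ) => Qr s * Real.exp (p.1 * s))
    ((hQ.comp continuous_snd).mul (Real.continuous_exp.comp ((continuous_fst.comp continuous_fst).mul continuous_snd)))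
    continuous_snd

/-- A continuous real forcing is bounded on `[-T, T]`. [folklore] -/
theorem exists_bound_Icc (hQ : Continuous Qr) (T : ℝ) : ∃ C : ℝ, 0 ≤ C ∧ ∀ s ∈ Icc (-T) T, |Qr s| ≤ C := by
  obtain ⟨C, hC⟩ := (isCompact_Icc (a := -T) (b := T)).exists_bound_of_continuousOn (f := Qr) hQ.continuousOn
  exact ⟨max C 0, le_max_right _ _, fun s hs => ((Real.norm_eq_abs _).symm.trans_le (hC s hs)).trans (le_max_left _ _)⟩

/-- **Local bound for the scalar Duhamel function**: for `0 ≤ L ≤ Λ` and `|t| ≤ T`,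
`|φ_L(t)| ≤ e^{ΛT} (|δ| + T · C · e^{ΛT})` where `C` bounds `|Qr|` on `[-T, T]`. [folklore] -/
theorem abs_duhamelScalar_le {Λ T C L t : ℝ} (hL0 : 0 ≤ L) (hL : L ≤ Λ) (hT : |t| ≤ T)
    (hC0 : 0 ≤ C) (hC : ∀ s ∈ Icc (-T) T, |Qr s| ≤ C) :
    |duhamelScalar δ Qr L t| ≤ Real.exp (Λ * T) * (|δ| + T * (C * Real.exp (Λ * T))) := by
  have hT0 : 0 ≤ T := (abs_nonneg t).trans hT
  have hexp : ∀ s : ℝ, |s| ≤ T → Real.exp (L * s) ≤ Real.exp (Λ * T) ∧ Real.exp (-(L * s)) ≤ Real.exp (Λ * T) := by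
    intro s hs
    have h1 : L * s ≤ Λ * T := by
      calc L * s ≤ L * |s| := mul_le_mul_of_nonneg_left (le_abs_self s) hL0
        _ ≤ Λ * T := mul_le_mul hL hs (abs_nonneg s) (hL0.trans hL)
    have h2 : -(L * s) ≤ Λ * T := by
      calc -(L * s) = L * (-s) := by ring
        _ ≤ L * |s| := mul_le_mul_of_nonneg_left (neg_le_abs s) hL0
        _ ≤ Λ * T := mul_le_mul hL hs (abs_nonneg s) (hL0.trans hL)
    exact ⟨Real.exp_le_exp.2 h1, Real.exp_le_exp.2 h2⟩
  have hint : |∫ s in (0 : ℝ)..t, Qr s * Real.exp (L * s)| ≤ T * (C * Real.exp (Λ * T)) := by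
    have h := intervalIntegral.norm_integral_le_of_norm_le_const (a := 0) (b := t) (C := C * Real.exp (Λ * T))
      (f := fun s => Qr s * Real.exp (L * s)) fun s hs => by
        have hs' : |s| ≤ T := by
          rcases le_or_gt 0 t with ht | ht
          · rw [uIoc_of_le ht] at hs
            rw [abs_of_pos hs.1]
            exact hs.2.trans ((le_abs_self t).trans hT)
          · rw [uIoc_of_ge ht.le] at hs
            rw [abs_of_nonpos hs.2]
            have : -t ≤ T := (neg_le_abs t).trans hT
            linarith [hs.1]
        have hsT : s ∈ Icc (-T) T := ⟨by linarith [neg_abs_le s, hs'], (le_abs_self s).trans hs'⟩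
        rw [norm_mul, Real.norm_eq_abs, Real.norm_eq_abs, abs_of_pos (Real.exp_pos _)]
        exact mul_le_mul (hC s hsT) (hexp s hs').1 (Real.exp_pos _).le hC0
    rw [Real.norm_eq_abs, sub_zero] at h
    exact h.trans (by nlinarith [Real.exp_pos (Λ * T), mul_nonneg hC0 (Real.exp_pos (Λ * T)).le])
  rw [duhamelScalar, abs_mul, Real.abs_exp]
  refine mul_le_mul (hexp t hT).2 ((abs_add_le _ _).trans (by linarith)) (abs_nonneg _) (Real.exp_pos _).le

end Scalar

section ParamDeriv

variable {δ : ℝ} {Qr : ℝ → ℝ}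

/-- The heat symbol in terms of the heat rate, `τ ≥ 0`. [folklore] -/
theorem heatSymbol_eq_exp_heatRate {τ : ℝ} (hτ : 0 ≤ τ) (ξ : EuclideanSpace ℝ (Fin 3)) :
    heatSymbol τ ξ = ((Real.exp (-(heatRate ξ * τ)) : ℝ) : ℂ) := by
  rw [heatSymbol, max_eq_left hτ, heatRate]
  ring_nf

/-- **Local bounds** for the scalar Duhamel functions near a time `t₀`, uniformly over the
frequencies of a ball `|ξ| ≤ R`. [folklore] -/
theorem exists_local_bound (hQ : Continuous Qr) (δ R t₀ : ℝ) :
    ∃ B C : ℝ, 0 ≤ B ∧ 0 ≤ C ∧ (∀ t ∈ ball t₀ 1, |Qr t| ≤ C) ∧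
      ∀ t ∈ ball t₀ 1, ∀ ξ : EuclideanSpace ℝ (Fin 3), ‖ξ‖ ≤ R →
        |duhamelScalar δ Qr (heatRate ξ) t| ≤ B := by
  set Λ : ℝ := 4 * Real.pi ^ 2 * R ^ 2 with hΛ
  set T : ℝ := |t₀| + 1 with hT
  obtain ⟨C, hC0, hC⟩ := exists_bound_Icc hQ T
  have htball : ∀ t ∈ ball t₀ 1, |t| ≤ T ∧ t ∈ Icc (-T) T := by
    intro t ht
    rw [mem_ball, Real.dist_eq] at ht
    have h1 := abs_sub_abs_le_abs_sub t t₀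
    have h2 := neg_abs_le t
    have h3 := le_abs_self t
    refine ⟨by linarith, ⟨by linarith, by linarith⟩⟩
  refine ⟨Real.exp (Λ * T) * (|δ| + T * (C * Real.exp (Λ * T))), C, by positivity, hC0,
    fun t ht => hC t (htball t ht).2, fun t ht ξ hξ => ?_⟩
  exact abs_duhamelScalar_le (heatRate_nonneg ξ) (heatRate_le (mem_closedBall_zero_iff.2 hξ)) (htball t ht).1 hC0 hC

/-- The frequency integrands `φ_{λ(ξ)}(t)^k w(ξ)` are integrable (weight integrable and supported
in a ball). [folklore] -/
theorem integrable_duhamelScalar_pow_mul (hQ : Continuous Qr) {w : EuclideanSpace ℝ (Fin 3) → ℝ}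
    (hw : Integrable w) {R : ℝ}
    (hwR : ∀ᵐ ξ ∂(volume : Measure (EuclideanSpace ℝ (Fin 3))), R < ‖ξ‖ → w ξ = 0) (k : ℕ) (t : ℝ) :
    Integrable (fun ξ : EuclideanSpace ℝ (Fin 3) => duhamelScalar δ Qr (heatRate ξ) t ^ k * w ξ) := by
  obtain ⟨B, C, hB0, -, -, hφ⟩ := exists_local_bound hQ δ R t
  have hcont : Continuous fun ξ : EuclideanSpace ℝ (Fin 3) => duhamelScalar δ Qr (heatRate ξ) t :=
    (continuous_duhamelScalar₂ hQ).comp (continuous_heatRate.prodMk continuous_const)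
  refine Integrable.mono' (hw.norm.const_mul (B ^ k))
    (((hcont.pow k).aestronglyMeasurable).mul hw.aestronglyMeasurable) ?_
  filter_upwards [hwR] with ξ hξ
  by_cases hR : ‖ξ‖ ≤ R
  · rw [norm_mul]
    refine mul_le_mul_of_nonneg_right ?_ (norm_nonneg _)
    rw [Real.norm_eq_abs, abs_pow]
    exact pow_le_pow_left₀ (abs_nonneg _) (hφ t (mem_ball_self one_pos) ξ hR) k
  · simp [hξ (not_le.1 hR)]

/-- **Differentiation under the frequency integral.** For a continuous forcing `Qr`, an
integrable weight `w` vanishing a.e. off the ball `|ξ| ≤ R` and `k ∈ ℕ`, the function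
`t ↦ ∫ φ_{λ(ξ)}(t)^k w(ξ) dξ` is differentiable everywhere with derivative
`∫ k φ^{k-1} (-λ φ + Qr(t)) w dξ`, the derivative integrand being integrable (dominated
differentiation: on the ball, `λ ≤ 4π²R²` and `φ` is locally bounded, `abs_duhamelScalar_le`). [folklore] -/
theorem hasDerivAt_integral_duhamelScalar_pow (hQ : Continuous Qr) {w : EuclideanSpace ℝ (Fin 3) → ℝ}
    (hw : Integrable w) {R : ℝ}
    (hwR : ∀ᵐ ξ ∂(volume : Measure (EuclideanSpace ℝ (Fin 3))), R < ‖ξ‖ → w ξ = 0) (k : ℕ) (t₀ : ℝ) :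
    Integrable (fun ξ : EuclideanSpace ℝ (Fin 3) => ((k : ℝ) * duhamelScalar δ Qr (heatRate ξ) t₀ ^ (k - 1) *
        (-(heatRate ξ) * duhamelScalar δ Qr (heatRate ξ) t₀ + Qr t₀)) * w ξ) ∧
    HasDerivAt (fun t => ∫ ξ, duhamelScalar δ Qr (heatRate ξ) t ^ k * w ξ)
      (∫ ξ, ((k : ℝ) * duhamelScalar δ Qr (heatRate ξ) t₀ ^ (k - 1) *
        (-(heatRate ξ) * duhamelScalar δ Qr (heatRate ξ) t₀ + Qr t₀)) * w ξ) t₀ := by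
  set Λ : ℝ := 4 * Real.pi ^ 2 * R ^ 2 with hΛ
  have hΛ0 : 0 ≤ Λ := by positivity
  obtain ⟨B, C, hB0, hC0, hC, hφ⟩ := exists_local_bound hQ δ R t₀
  set K : ℝ := (k : ℝ) * B ^ (k - 1) * (Λ * B + C) with hK
  -- continuity in `ξ` of the integrands
  have hcont : ∀ t : ℝ, Continuous fun ξ : EuclideanSpace ℝ (Fin 3) => duhamelScalar δ Qr (heatRate ξ) t :=
    fun t => (continuous_duhamelScalar₂ hQ).comp (continuous_heatRate.prodMk continuous_const)
  have hmeasF : ∀ t : ℝ, AEStronglyMeasurable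
      (fun ξ : EuclideanSpace ℝ (Fin 3) => duhamelScalar δ Qr (heatRate ξ) t ^ k * w ξ) volume :=
    fun t => (((hcont t).pow k).aestronglyMeasurable).mul hw.aestronglyMeasurable
  have hmeasF' : ∀ t : ℝ, AEStronglyMeasurable (fun ξ : EuclideanSpace ℝ (Fin 3) =>
      ((k : ℝ) * duhamelScalar δ Qr (heatRate ξ) t ^ (k - 1) *
        (-(heatRate ξ) * duhamelScalar δ Qr (heatRate ξ) t + Qr t)) * w ξ) volume := fun t =>
    (((continuous_const.mul ((hcont t).pow (k - 1))).mul
      ((continuous_heatRate.neg.mul (hcont t)).add continuous_const)).aestronglyMeasurable).mul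
      hw.aestronglyMeasurable
  have hbound : ∀ᵐ ξ ∂(volume : Measure (EuclideanSpace ℝ (Fin 3))), ∀ t ∈ ball t₀ 1,
      ‖((k : ℝ) * duhamelScalar δ Qr (heatRate ξ) t ^ (k - 1) *
        (-(heatRate ξ) * duhamelScalar δ Qr (heatRate ξ) t + Qr t)) * w ξ‖ ≤ K * ‖w ξ‖ := by
    filter_upwards [hwR] with ξ hξ t ht
    by_cases hR : ‖ξ‖ ≤ R
    · rw [norm_mul]
      refine mul_le_mul_of_nonneg_right ?_ (norm_nonneg _)
      have h1 := hφ t ht ξ hR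
      have h2 : |Qr t| ≤ C := hC t ht
      have h3 : heatRate ξ ≤ Λ := heatRate_le (mem_closedBall_zero_iff.2 hR)
      have h4 : |-(heatRate ξ) * duhamelScalar δ Qr (heatRate ξ) t + Qr t| ≤ Λ * B + C := by
        calc |-(heatRate ξ) * duhamelScalar δ Qr (heatRate ξ) t + Qr t|
            ≤ |-(heatRate ξ) * duhamelScalar δ Qr (heatRate ξ) t| + |Qr t| := abs_add_le _ _
          _ = heatRate ξ * |duhamelScalar δ Qr (heatRate ξ) t| + |Qr t| := by
              rw [abs_mul, abs_neg, abs_of_nonneg (heatRate_nonneg ξ)]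
          _ ≤ Λ * B + C := add_le_add (mul_le_mul h3 h1 (abs_nonneg _) hΛ0) h2
      rw [Real.norm_eq_abs, abs_mul, abs_mul, Nat.abs_cast, abs_pow, hK]
      gcongr
    · simp [hξ (not_le.1 hR)]
  have hdiff : ∀ᵐ ξ ∂(volume : Measure (EuclideanSpace ℝ (Fin 3))), ∀ t ∈ ball t₀ 1,
      HasDerivAt (fun t => duhamelScalar δ Qr (heatRate ξ) t ^ k * w ξ)
        (((k : ℝ) * duhamelScalar δ Qr (heatRate ξ) t ^ (k - 1) *
          (-(heatRate ξ) * duhamelScalar δ Qr (heatRate ξ) t + Qr t)) * w ξ) t :=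
    Eventually.of_forall fun ξ t _ => ((hasDerivAt_duhamelScalar hQ (heatRate ξ) t).pow k).mul_const (w ξ)
  exact hasDerivAt_integral_of_dominated_loc_of_deriv_le (ball_mem_nhds t₀ one_pos)
    (Eventually.of_forall hmeasF) (integrable_duhamelScalar_pow_mul hQ hw hwR k t₀) (hmeasF' t₀) hbound
    (hw.norm.const_mul K) hdiff

end ParamDeriv

/-! ## Part IX: the mode's coefficient and energy as smooth functions of time -/

section ModeScalars

variable {ε₀ : ℝ} {m : ℕ} {𝒟 : CascadeWaveletData ε₀ m}
  {α : Fin m → Fin m → Fin m → ℤ × ℤ × ℤ → ℝ} {u : ℝ → L2C} {i₀ i : Fin m} {n₀ n : ℤ}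

/-- The **real forcing of the mode** `Qr_{i,n}(s) = quadTerm_{i,n}(X(max(s,0)))` (the accepted real
`TaoCascade.quadTerm` of the coefficients, frozen at negative times). [cite: Tao2016AveragedNS, Lemma 4.1 (4.10)] -/
def modeForcingRe (𝒟 : CascadeWaveletData ε₀ m) (α : Fin m → Fin m → Fin m → ℤ × ℤ × ℤ → ℝ)
    (u : ℝ → L2C) (i : Fin m) (n : ℤ) (s : ℝ) : ℝ :=
  TaoCascade.quadTerm ε₀ α (modeCoeff 𝒟 u) i n (max s 0)

/-- On a real curve the complex forcing is the real forcing. [folklore] -/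
theorem modeForcing_eq_coe (hreal : ∀ s, 0 ≤ s → IsReal (u s)) (s : ℝ) :
    modeForcing 𝒟 α u i n s = ((modeForcingRe 𝒟 α u i n s : ℝ) : ℂ) :=
  modeForcing_eq_ofReal hreal s

/-- At nonnegative times the real forcing is `quadTerm_{i,n}(X(s))`. [folklore] -/
theorem modeForcingRe_of_nonneg {s : ℝ} (hs : 0 ≤ s) :
    modeForcingRe 𝒟 α u i n s = TaoCascade.quadTerm ε₀ α (modeCoeff 𝒟 u) i n s := by
  rw [modeForcingRe, max_eq_left hs]

/-- The real forcing of an `H¹⁰`-continuous real curve is continuous. [folklore] -/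
theorem continuous_modeForcingRe (hu : ContinuousInH10On (Ici 0) u) (hreal : ∀ s, 0 ≤ s → IsReal (u s)) :
    Continuous (modeForcingRe 𝒟 α u i n) := by
  have h := Complex.continuous_re.comp (continuous_modeForcing (𝒟 := 𝒟) (α := α) (i := i) (n := n) hu)
  refine h.congr fun s => ?_
  simp [modeForcing_eq_coe hreal]

/-- The **frequency weight of the mode**: `ρ_{i,n}(ξ) = |ψ̂_{i,n}(ξ)|²`, a probability density
(`∫ ρ = ‖ψ_{i,n}‖² = 1`) supported in the annulus of the mode. [cite: Tao2016AveragedNS, Lemma 4.1] -/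
def modeWeight (𝒟 : CascadeWaveletData ε₀ m) (i : Fin m) (n : ℤ) (ξ : EuclideanSpace ℝ (Fin 3)) : ℝ :=
  ‖fourierFn (cascadeWavelet ε₀ (𝒟.ψ i) n) ξ‖ ^ 2

/-- The weight is nonnegative. [folklore] -/
theorem modeWeight_nonneg (ξ : EuclideanSpace ℝ (Fin 3)) : 0 ≤ modeWeight 𝒟 i n ξ := by
  unfold modeWeight; positivity

/-- The weight is integrable. [folklore] -/
theorem integrable_modeWeight : Integrable (modeWeight 𝒟 i n) := by
  have h : MemLp (fourierFn (cascadeWavelet ε₀ (𝒟.ψ i) n)) 2 (volume : Measure (EuclideanSpace ℝ (Fin 3))) :=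
    Lp.memLp (𝓕 (cascadeWavelet ε₀ (𝒟.ψ i) n) : L2C)
  exact h.norm.integrable_sq

/-- The weight has total mass one. [cite: Tao2016AveragedNS, §4 p. 21] -/
theorem integral_modeWeight (hε : 0 < 1 + ε₀) : ∫ ξ, modeWeight 𝒟 i n ξ = 1 := by
  unfold modeWeight
  rw [← norm_sq_eq_integral_fourierFn, 𝒟.norm_cascadeWavelet hε, one_pow]

/-- The outer radius of the frequency annulus of the mode, `(1+ε₀)ⁿ (1 + ε₀/2)`. [cite: Tao2016AveragedNS, Lemma 4.1] -/
def modeRadius (ε₀ : ℝ) (n : ℤ) : ℝ := (1 + ε₀) ^ n * (1 + ε₀ / 2)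

/-- The weight vanishes a.e. off the ball `|ξ| ≤ (1+ε₀)ⁿ(1+ε₀/2)`. [cite: Tao2016AveragedNS, Lemma 4.1] -/
theorem modeWeight_eq_zero (hε : 0 < 1 + ε₀) :
    ∀ᵐ ξ ∂(volume : Measure (EuclideanSpace ℝ (Fin 3))), modeRadius ε₀ n < ‖ξ‖ → modeWeight 𝒟 i n ξ = 0 := by
  filter_upwards [𝒟.fourierFn_cascadeWavelet_eq_zero hε i n] with ξ hξ hR
  have h : ξ ∉ freqRegion 𝒟 i n := fun h => not_le.2 hR (𝒟.norm_of_mem_freqRegion hε i n h).2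
  simp [modeWeight, hξ h]

/-- The **mode's scalar coefficient** `X̃_{i,n}(t) = ∫ φ_{λ(ξ)}(t) ρ_{i,n}(ξ) dξ`, defined and smooth
for all `t ∈ ℝ`; it agrees with `X_{i,n}` on `[0,+∞)` (`modeCoeff_eq_modeScalarX`). [cite: Tao2016AveragedNS, Lemma 4.1 (4.14)] -/
def modeScalarX (𝒟 : CascadeWaveletData ε₀ m) (α : Fin m → Fin m → Fin m → ℤ × ℤ × ℤ → ℝ)
    (u : ℝ → L2C) (i : Fin m) (n : ℤ) (i₀ : Fin m) (n₀ : ℤ) (t : ℝ) : ℝ :=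
  ∫ ξ, duhamelScalar (modeDelta i₀ i n₀ n) (modeForcingRe 𝒟 α u i n) (heatRate ξ) t * modeWeight 𝒟 i n ξ

/-- The **mode's scalar energy** `Ẽ_{i,n}(t) = ½ ∫ φ_{λ(ξ)}(t)² ρ_{i,n}(ξ) dξ`, defined and smooth
for all `t`; it agrees with `E_{i,n}` on `[0,+∞)` (`modeEnergy_eq_modeScalarE`). [cite: Tao2016AveragedNS, Lemma 4.1 (4.5)] -/
def modeScalarE (𝒟 : CascadeWaveletData ε₀ m) (α : Fin m → Fin m → Fin m → ℤ × ℤ × ℤ → ℝ)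
    (u : ℝ → L2C) (i : Fin m) (n : ℤ) (i₀ : Fin m) (n₀ : ℤ) (t : ℝ) : ℝ :=
  (∫ ξ, duhamelScalar (modeDelta i₀ i n₀ n) (modeForcingRe 𝒟 α u i n) (heatRate ξ) t ^ 2 *
    modeWeight 𝒟 i n ξ) / 2

/-- **The symbol is the scalar Duhamel function**: for `t ≥ 0`,
`Re m_t(ξ) = φ_{λ(ξ)}(t) = e^{-λt}(δ + ∫₀ᵗ Qr e^{λs} ds)`. [cite: Tao2016AveragedNS, Lemma 4.1 (4.14)] -/
theorem modeSymbol_re_eq_duhamelScalar (hreal : ∀ s, 0 ≤ s → IsReal (u s)) {t : ℝ} (ht : 0 ≤ t)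
    (ξ : EuclideanSpace ℝ (Fin 3)) :
    (modeSymbol 𝒟 α u i n i₀ n₀ t ξ).re =
      duhamelScalar (modeDelta i₀ i n₀ n) (modeForcingRe 𝒟 α u i n) (heatRate ξ) t := by
  have hint : duhamelSymbolFn (modeForcing 𝒟 α u i n) t ξ =
      ((∫ s in (0 : ℝ)..t, modeForcingRe 𝒟 α u i n s * Real.exp (-(heatRate ξ * (t - s))) : ℝ) : ℂ) := by
    rw [duhamelSymbolFn, ← intervalIntegral.integral_ofReal]
    refine intervalIntegral.integral_congr fun s hs => ?_
    rw [uIcc_of_le ht] at hs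
    show modeForcing 𝒟 α u i n s * heatSymbol (t - s) ξ = _
    rw [modeForcing_eq_coe hreal, heatSymbol_eq_exp_heatRate (by linarith [hs.2])]
    push_cast
    ring
  rw [modeSymbol, hint, heatSymbol_eq_exp_heatRate ht, ← Complex.ofReal_mul, ← Complex.ofReal_add,
    Complex.ofReal_re, duhamelScalar, mul_add, ← intervalIntegral.integral_const_mul]
  congr 1
  · ring
  · refine intervalIntegral.integral_congr fun s _ => ?_
    show modeForcingRe 𝒟 α u i n s * Real.exp (-(heatRate ξ * (t - s))) = _
    rw [show -(heatRate ξ * (t - s)) = -(heatRate ξ * t) + heatRate ξ * s by ring, Real.exp_add]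
    ring

/-- **`X_{i,n} = X̃_{i,n}` on `[0,+∞)`.** [cite: Tao2016AveragedNS, Lemma 4.1 (4.14)] -/
theorem modeCoeff_eq_modeScalarX (hε : 0 < ε₀)
    (hu : IsMildSolutionFor (cascadeOperatorForm ε₀ 𝒟.ψ α) (cascadeWavelet ε₀ (𝒟.ψ i₀) n₀) (Ici 0) u)
    {t : ℝ} (ht : 0 ≤ t) :
    modeCoeff 𝒟 u i n t = modeScalarX 𝒟 α u i n i₀ n₀ t := by
  rw [modeCoeff_eq_integral hε hu ht, modeScalarX]
  refine integral_congr_ae (Eventually.of_forall fun ξ => ?_)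
  simp only [modeWeight]
  rw [modeSymbol_re_eq_duhamelScalar (fun s hs => (hu.1 s hs).2.1) ht]

/-- **`E_{i,n} = Ẽ_{i,n}` on `[0,+∞)`.** [cite: Tao2016AveragedNS, Lemma 4.1 (4.5)] -/
theorem modeEnergy_eq_modeScalarE (hε : 0 < ε₀)
    (hu : IsMildSolutionFor (cascadeOperatorForm ε₀ 𝒟.ψ α) (cascadeWavelet ε₀ (𝒟.ψ i₀) n₀) (Ici 0) u)
    {t : ℝ} (ht : 0 ≤ t) :
    modeEnergy 𝒟 u i n t = modeScalarE 𝒟 α u i n i₀ n₀ t := by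
  rw [modeEnergy_eq_integral hε hu ht, modeScalarE]
  congr 1
  refine integral_congr_ae (Eventually.of_forall fun ξ => ?_)
  simp only [modeWeight]
  rw [modeSymbol_re_eq_duhamelScalar (fun s hs => (hu.1 s hs).2.1) ht]

end ModeScalars

/-! ## Part X: the derivatives of `X̃_{i,n}`, `Ẽ_{i,n}` and the estimates (4.8)–(4.12) -/

section Estimates

variable {ε₀ : ℝ} {m : ℕ} {𝒟 : CascadeWaveletData ε₀ m}
  {α : Fin m → Fin m → Fin m → ℤ × ℤ × ℤ → ℝ} {u : ℝ → L2C} {i₀ i : Fin m} {n₀ n : ℤ}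

/-- The bound `Λ_n = 4π² ((1+ε₀)ⁿ(1+ε₀/2))²` of the heat rate on the frequency support of the mode. [folklore] -/
def modeRateBound (ε₀ : ℝ) (n : ℤ) : ℝ := 4 * Real.pi ^ 2 * modeRadius ε₀ n ^ 2

/-- `Λ_n ≥ 0`. [folklore] -/
theorem modeRateBound_nonneg (ε₀ : ℝ) (n : ℤ) : 0 ≤ modeRateBound ε₀ n := by
  unfold modeRateBound; positivity

/-- The **rate-weighted density** `λ ρ_{i,n}` is integrable (the rate is bounded on the support). [folklore] -/
theorem integrable_heatRate_mul_modeWeight (hε : 0 < 1 + ε₀) :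
    Integrable (fun ξ => heatRate ξ * modeWeight 𝒟 i n ξ) := by
  refine Integrable.mono' ((integrable_modeWeight (𝒟 := 𝒟) (i := i) (n := n)).const_mul (modeRateBound ε₀ n))
    ((continuous_heatRate.aestronglyMeasurable).mul integrable_modeWeight.aestronglyMeasurable) ?_
  filter_upwards [modeWeight_eq_zero (𝒟 := 𝒟) (i := i) (n := n) hε] with ξ hξ
  rw [Real.norm_eq_abs, abs_mul, abs_of_nonneg (heatRate_nonneg ξ), abs_of_nonneg (modeWeight_nonneg ξ)]
  by_cases hR : ‖ξ‖ ≤ modeRadius ε₀ n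
  · exact mul_le_mul_of_nonneg_right (heatRate_le (mem_closedBall_zero_iff.2 hR)) (modeWeight_nonneg ξ)
  · rw [hξ (not_le.1 hR), mul_zero, mul_zero]

/-- The rate-weighted density vanishes where the density does. [folklore] -/
theorem heatRate_mul_modeWeight_eq_zero (hε : 0 < 1 + ε₀) :
    ∀ᵐ ξ ∂(volume : Measure (EuclideanSpace ℝ (Fin 3))), modeRadius ε₀ n < ‖ξ‖ →
      heatRate ξ * modeWeight 𝒟 i n ξ = 0 := by
  filter_upwards [modeWeight_eq_zero (𝒟 := 𝒟) (i := i) (n := n) hε] with ξ hξ hR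
  rw [hξ hR, mul_zero]

/-- Shorthand: the mode's scalar function `φ_{λ(ξ)}(t)`. [folklore] -/
abbrev modeφ (𝒟 : CascadeWaveletData ε₀ m) (α : Fin m → Fin m → Fin m → ℤ × ℤ × ℤ → ℝ)
    (u : ℝ → L2C) (i : Fin m) (n : ℤ) (i₀ : Fin m) (n₀ : ℤ) (ξ : EuclideanSpace ℝ (Fin 3)) (t : ℝ) : ℝ :=
  duhamelScalar (modeDelta i₀ i n₀ n) (modeForcingRe 𝒟 α u i n) (heatRate ξ) t

/-- The **dissipation of the coefficient**, `A(t) = ∫ λ(ξ) φ(ξ,t) ρ(ξ) dξ` (`= -⟨Δ u_{i,n}, ψ_{i,n}⟩`, the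
`O((1+ε₀)^{2n} E^{1/2})` term of (4.10)). [cite: Tao2016AveragedNS, Lemma 4.1 (4.10)] -/
def modeDissX (𝒟 : CascadeWaveletData ε₀ m) (α : Fin m → Fin m → Fin m → ℤ × ℤ × ℤ → ℝ)
    (u : ℝ → L2C) (i : Fin m) (n : ℤ) (i₀ : Fin m) (n₀ : ℤ) (t : ℝ) : ℝ :=
  ∫ ξ, modeφ 𝒟 α u i n i₀ n₀ ξ t ^ 1 * (heatRate ξ * modeWeight 𝒟 i n ξ)

/-- The **dissipation of the energy**, `B(t) = ∫ λ(ξ) φ(ξ,t)² ρ(ξ) dξ ≥ 0` (`= -⟨Δ u_{i,n}, u_{i,n}⟩`,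
dropped in (4.11)). [cite: Tao2016AveragedNS, Lemma 4.1 (4.11)] -/
def modeDissE (𝒟 : CascadeWaveletData ε₀ m) (α : Fin m → Fin m → Fin m → ℤ × ℤ × ℤ → ℝ)
    (u : ℝ → L2C) (i : Fin m) (n : ℤ) (i₀ : Fin m) (n₀ : ℤ) (t : ℝ) : ℝ :=
  ∫ ξ, modeφ 𝒟 α u i n i₀ n₀ ξ t ^ 2 * (heatRate ξ * modeWeight 𝒟 i n ξ)

/-- `B(t) ≥ 0`. [folklore] -/
theorem modeDissE_nonneg (t : ℝ) : 0 ≤ modeDissE 𝒟 α u i n i₀ n₀ t :=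
  integral_nonneg fun ξ => mul_nonneg (sq_nonneg _) (mul_nonneg (heatRate_nonneg ξ) (modeWeight_nonneg ξ))

/-- **`X̃' = -A + Qr`** (differentiate under the integral; `∫ ρ = 1`). [cite: Tao2016AveragedNS, Lemma 4.1 (4.10)] -/
theorem hasDerivAt_modeScalarX (hε : 0 < 1 + ε₀) (hQ : Continuous (modeForcingRe 𝒟 α u i n)) (t : ℝ) :
    HasDerivAt (modeScalarX 𝒟 α u i n i₀ n₀)
      (-modeDissX 𝒟 α u i n i₀ n₀ t + modeForcingRe 𝒟 α u i n t) t := by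
  have h := (hasDerivAt_integral_duhamelScalar_pow (δ := modeDelta i₀ i n₀ n) hQ integrable_modeWeight
    (modeWeight_eq_zero (𝒟 := 𝒟) (i := i) (n := n) hε) 1 t)
  have hA := integrable_duhamelScalar_pow_mul (δ := modeDelta i₀ i n₀ n) hQ
    (integrable_heatRate_mul_modeWeight (𝒟 := 𝒟) (i := i) (n := n) hε)
    (heatRate_mul_modeWeight_eq_zero hε) 1 t
  have hform : (fun t => ∫ ξ, duhamelScalar (modeDelta i₀ i n₀ n) (modeForcingRe 𝒟 α u i n) (heatRate ξ) t ^ 1 *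
      modeWeight 𝒟 i n ξ) = modeScalarX 𝒟 α u i n i₀ n₀ := by
    funext s
    simp [modeScalarX]
  rw [hform] at h
  refine h.2.congr_deriv ?_
  have hsplit : ∀ ξ : EuclideanSpace ℝ (Fin 3), ((1 : ℕ) : ℝ) *
      duhamelScalar (modeDelta i₀ i n₀ n) (modeForcingRe 𝒟 α u i n) (heatRate ξ) t ^ (1 - 1) *
        (-(heatRate ξ) * duhamelScalar (modeDelta i₀ i n₀ n) (modeForcingRe 𝒟 α u i n) (heatRate ξ) t +
          modeForcingRe 𝒟 α u i n t) * modeWeight 𝒟 i n ξ =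
      modeForcingRe 𝒟 α u i n t * modeWeight 𝒟 i n ξ -
        duhamelScalar (modeDelta i₀ i n₀ n) (modeForcingRe 𝒟 α u i n) (heatRate ξ) t ^ 1 *
          (heatRate ξ * modeWeight 𝒟 i n ξ) := by
    intro ξ; ring
  simp_rw [hsplit]
  rw [integral_sub (integrable_modeWeight.const_mul _) hA, integral_const_mul,
    integral_modeWeight hε, mul_one, modeDissX]
  ring

/-- **`Ẽ' = -B + Qr X̃`** (differentiate under the integral). [cite: Tao2016AveragedNS, Lemma 4.1 (4.11)] -/
theorem hasDerivAt_modeScalarE (hε : 0 < 1 + ε₀) (hQ : Continuous (modeForcingRe 𝒟 α u i n)) (t : ℝ) :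
    HasDerivAt (modeScalarE 𝒟 α u i n i₀ n₀)
      (-modeDissE 𝒟 α u i n i₀ n₀ t + modeForcingRe 𝒟 α u i n t * modeScalarX 𝒟 α u i n i₀ n₀ t) t := by
  have h := (hasDerivAt_integral_duhamelScalar_pow (δ := modeDelta i₀ i n₀ n) hQ integrable_modeWeight
    (modeWeight_eq_zero (𝒟 := 𝒟) (i := i) (n := n) hε) 2 t)
  have hB := integrable_duhamelScalar_pow_mul (δ := modeDelta i₀ i n₀ n) hQ
    (integrable_heatRate_mul_modeWeight (𝒟 := 𝒟) (i := i) (n := n) hε)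
    (heatRate_mul_modeWeight_eq_zero hε) 2 t
  have hX := integrable_duhamelScalar_pow_mul (δ := modeDelta i₀ i n₀ n) hQ integrable_modeWeight
    (modeWeight_eq_zero (𝒟 := 𝒟) (i := i) (n := n) hε) 1 t
  have h2 := h.2.div_const 2
  have hform : (fun t => (∫ ξ, duhamelScalar (modeDelta i₀ i n₀ n) (modeForcingRe 𝒟 α u i n) (heatRate ξ) t ^ 2 *
      modeWeight 𝒟 i n ξ) / 2) = modeScalarE 𝒟 α u i n i₀ n₀ := by
    funext s
    simp [modeScalarE]
  rw [hform] at h2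
  refine h2.congr_deriv ?_
  have hsplit : ∀ ξ : EuclideanSpace ℝ (Fin 3), ((2 : ℕ) : ℝ) *
      duhamelScalar (modeDelta i₀ i n₀ n) (modeForcingRe 𝒟 α u i n) (heatRate ξ) t ^ (2 - 1) *
        (-(heatRate ξ) * duhamelScalar (modeDelta i₀ i n₀ n) (modeForcingRe 𝒟 α u i n) (heatRate ξ) t +
          modeForcingRe 𝒟 α u i n t) * modeWeight 𝒟 i n ξ =
      (2 : ℝ) * (modeForcingRe 𝒟 α u i n t *
        (duhamelScalar (modeDelta i₀ i n₀ n) (modeForcingRe 𝒟 α u i n) (heatRate ξ) t ^ 1 * modeWeight 𝒟 i n ξ) -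
        duhamelScalar (modeDelta i₀ i n₀ n) (modeForcingRe 𝒟 α u i n) (heatRate ξ) t ^ 2 *
          (heatRate ξ * modeWeight 𝒟 i n ξ)) := by
    intro ξ; ring
  simp_rw [hsplit]
  rw [integral_const_mul, integral_sub (hX.const_mul _) hB, integral_const_mul]
  simp only [modeDissE, modeScalarX, pow_one]
  ring

end Estimates

section Estimates2

variable {ε₀ : ℝ} {m : ℕ} {𝒟 : CascadeWaveletData ε₀ m}
  {α : Fin m → Fin m → Fin m → ℤ × ℤ × ℤ → ℝ} {u : ℝ → L2C} {i₀ i : Fin m} {n₀ n : ℤ}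

/-- `Ẽ ≥ 0`. [folklore] -/
theorem modeScalarE_nonneg (t : ℝ) : 0 ≤ modeScalarE 𝒟 α u i n i₀ n₀ t :=
  div_nonneg (integral_nonneg fun ξ => mul_nonneg (sq_nonneg _) (modeWeight_nonneg ξ)) zero_le_two

/-- **Cauchy–Schwarz against the probability density `ρ`**: `∫ |φ| ρ ≤ (∫ φ² ρ)^{1/2} = (2Ẽ)^{1/2}`
(Tao, p. 22: "From Cauchy–Schwarz we have `½X² ≤ E`" and "`O(E^{1/2} ‖Δψ_{i,n}‖)`"). [cite: Tao2016AveragedNS, Lemma 4.1 (4.12)] -/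
theorem integral_abs_modeφ_mul_le (hε : 0 < 1 + ε₀) (hQ : Continuous (modeForcingRe 𝒟 α u i n)) (t : ℝ) :
    ∫ ξ, |modeφ 𝒟 α u i n i₀ n₀ ξ t| * modeWeight 𝒟 i n ξ ≤ Real.sqrt (2 * modeScalarE 𝒟 α u i n i₀ n₀ t) := by
  have hcont : Continuous fun ξ : EuclideanSpace ℝ (Fin 3) => modeφ 𝒟 α u i n i₀ n₀ ξ t :=
    (continuous_duhamelScalar₂ hQ).comp (continuous_heatRate.prodMk continuous_const)
  have hρm : AEStronglyMeasurable (modeWeight 𝒟 i n) volume := integrable_modeWeight.aestronglyMeasurable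
  have hfm : AEStronglyMeasurable (fun ξ : EuclideanSpace ℝ (Fin 3) =>
      |modeφ 𝒟 α u i n i₀ n₀ ξ t| * Real.sqrt (modeWeight 𝒟 i n ξ)) volume :=
    (hcont.abs.aestronglyMeasurable).mul (Real.continuous_sqrt.comp_aestronglyMeasurable hρm)
  have hgm : AEStronglyMeasurable (fun ξ : EuclideanSpace ℝ (Fin 3) => Real.sqrt (modeWeight 𝒟 i n ξ)) volume :=
    Real.continuous_sqrt.comp_aestronglyMeasurable hρm
  have hf2 : ∀ ξ, (|modeφ 𝒟 α u i n i₀ n₀ ξ t| * Real.sqrt (modeWeight 𝒟 i n ξ)) ^ 2 =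
      modeφ 𝒟 α u i n i₀ n₀ ξ t ^ 2 * modeWeight 𝒟 i n ξ := fun ξ => by
    rw [mul_pow, sq_abs, Real.sq_sqrt (modeWeight_nonneg ξ)]
  have hg2 : ∀ ξ, Real.sqrt (modeWeight 𝒟 i n ξ) ^ 2 = modeWeight 𝒟 i n ξ := fun ξ =>
    Real.sq_sqrt (modeWeight_nonneg ξ)
  have hfL : MemLp (fun ξ : EuclideanSpace ℝ (Fin 3) =>
      |modeφ 𝒟 α u i n i₀ n₀ ξ t| * Real.sqrt (modeWeight 𝒟 i n ξ)) (ENNReal.ofReal 2) volume := by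
    rw [ENNReal.ofReal_ofNat, memLp_two_iff_integrable_sq hfm]
    simp_rw [hf2]
    exact integrable_duhamelScalar_pow_mul hQ integrable_modeWeight (modeWeight_eq_zero (𝒟 := 𝒟) hε) 2 t
  have hgL : MemLp (fun ξ : EuclideanSpace ℝ (Fin 3) => Real.sqrt (modeWeight 𝒟 i n ξ)) (ENNReal.ofReal 2) volume := by
    rw [ENNReal.ofReal_ofNat, memLp_two_iff_integrable_sq hgm]
    simp_rw [hg2]
    exact integrable_modeWeight
  have h := integral_mul_le_Lp_mul_Lq_of_nonneg Real.HolderConjugate.two_two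
    (Eventually.of_forall fun ξ => by positivity) (Eventually.of_forall fun ξ => Real.sqrt_nonneg _) hfL hgL
  have k1 : ∫ ξ, |modeφ 𝒟 α u i n i₀ n₀ ξ t| * Real.sqrt (modeWeight 𝒟 i n ξ) * Real.sqrt (modeWeight 𝒟 i n ξ) =
      ∫ ξ, |modeφ 𝒟 α u i n i₀ n₀ ξ t| * modeWeight 𝒟 i n ξ :=
    integral_congr_ae (Eventually.of_forall fun ξ => by
      simp only [mul_assoc, ← pow_two, Real.sq_sqrt (modeWeight_nonneg ξ)])
  have k2 : ∫ ξ, (|modeφ 𝒟 α u i n i₀ n₀ ξ t| * Real.sqrt (modeWeight 𝒟 i n ξ)) ^ (2 : ℝ) =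
      ∫ ξ, modeφ 𝒟 α u i n i₀ n₀ ξ t ^ 2 * modeWeight 𝒟 i n ξ :=
    integral_congr_ae (Eventually.of_forall fun ξ => by simp only [Real.rpow_two, hf2])
  have k3 : ∫ ξ, Real.sqrt (modeWeight 𝒟 i n ξ) ^ (2 : ℝ) = 1 := by
    rw [← integral_modeWeight (𝒟 := 𝒟) (i := i) (n := n) hε]
    exact integral_congr_ae (Eventually.of_forall fun ξ => by simp only [Real.rpow_two, hg2])
  rw [k1, k2, k3, Real.one_rpow, mul_one] at h
  refine h.trans (le_of_eq ?_)
  rw [Real.sqrt_eq_rpow, modeScalarE]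
  congr 1
  ring

/-- `|X̃| ≤ (2Ẽ)^{1/2}`, i.e. **(4.12), lower half: `½ X̃² ≤ Ẽ`** (below). [cite: Tao2016AveragedNS, Lemma 4.1 (4.12)] -/
theorem abs_modeScalarX_le (hε : 0 < 1 + ε₀) (hQ : Continuous (modeForcingRe 𝒟 α u i n)) (t : ℝ) :
    |modeScalarX 𝒟 α u i n i₀ n₀ t| ≤ Real.sqrt (2 * modeScalarE 𝒟 α u i n i₀ n₀ t) := by
  refine le_trans ?_ (integral_abs_modeφ_mul_le hε hQ t)
  rw [modeScalarX, ← Real.norm_eq_abs]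
  refine (norm_integral_le_integral_norm _).trans (le_of_eq (integral_congr_ae (Eventually.of_forall fun ξ => ?_)))
  simp only [Real.norm_eq_abs, abs_mul, abs_of_nonneg (modeWeight_nonneg ξ)]

/-- **(4.12), lower half**: `½ X̃² ≤ Ẽ`. [cite: Tao2016AveragedNS, Lemma 4.1 (4.12)] -/
theorem half_sq_modeScalarX_le (hε : 0 < 1 + ε₀) (hQ : Continuous (modeForcingRe 𝒟 α u i n)) (t : ℝ) :
    (1 / 2) * modeScalarX 𝒟 α u i n i₀ n₀ t ^ 2 ≤ modeScalarE 𝒟 α u i n i₀ n₀ t := by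
  have h := abs_modeScalarX_le (i₀ := i₀) (n₀ := n₀) hε hQ t
  have hE := modeScalarE_nonneg (𝒟 := 𝒟) (α := α) (u := u) (i := i) (n := n) (i₀ := i₀) (n₀ := n₀) t
  have h2 : modeScalarX 𝒟 α u i n i₀ n₀ t ^ 2 ≤ 2 * modeScalarE 𝒟 α u i n i₀ n₀ t := by
    calc modeScalarX 𝒟 α u i n i₀ n₀ t ^ 2 = |modeScalarX 𝒟 α u i n i₀ n₀ t| ^ 2 := (sq_abs _).symm
      _ ≤ Real.sqrt (2 * modeScalarE 𝒟 α u i n i₀ n₀ t) ^ 2 := pow_le_pow_left₀ (abs_nonneg _) h 2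
      _ = 2 * modeScalarE 𝒟 α u i n i₀ n₀ t := Real.sq_sqrt (by linarith)
  linarith

/-- **The dissipation of the coefficient is `O(Λ_n E^{1/2})`**: `|A(t)| ≤ Λ_n (2Ẽ(t))^{1/2}`
(`⟨Δu_{i,n}, ψ_{i,n}⟩ = O(E^{1/2} ‖Δψ_{i,n}‖) = O((1+ε₀)^{2n} E^{1/2})`, p. 22). [cite: Tao2016AveragedNS, Lemma 4.1 (4.10)] -/
theorem abs_modeDissX_le (hε : 0 < 1 + ε₀) (hQ : Continuous (modeForcingRe 𝒟 α u i n)) (t : ℝ) :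
    |modeDissX 𝒟 α u i n i₀ n₀ t| ≤ modeRateBound ε₀ n * Real.sqrt (2 * modeScalarE 𝒟 α u i n i₀ n₀ t) := by
  have hA := integrable_duhamelScalar_pow_mul (δ := modeDelta i₀ i n₀ n) hQ
    (integrable_heatRate_mul_modeWeight (𝒟 := 𝒟) (i := i) (n := n) hε) (heatRate_mul_modeWeight_eq_zero hε) 1 t
  have h1 := integrable_duhamelScalar_pow_mul (δ := modeDelta i₀ i n₀ n) hQ integrable_modeWeight
    (modeWeight_eq_zero (𝒟 := 𝒟) (i := i) (n := n) hε) 1 t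
  calc |modeDissX 𝒟 α u i n i₀ n₀ t|
      ≤ ∫ ξ, ‖modeφ 𝒟 α u i n i₀ n₀ ξ t ^ 1 * (heatRate ξ * modeWeight 𝒟 i n ξ)‖ := by
        rw [modeDissX, ← Real.norm_eq_abs]
        exact norm_integral_le_integral_norm _
    _ ≤ ∫ ξ, modeRateBound ε₀ n * (|modeφ 𝒟 α u i n i₀ n₀ ξ t| * modeWeight 𝒟 i n ξ) := by
        refine integral_mono_ae hA.norm ?_ ?_
        · have := (h1.norm).const_mul (modeRateBound ε₀ n)
          refine this.congr (Eventually.of_forall fun ξ => ?_)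
          simp only [pow_one, Real.norm_eq_abs, abs_mul, abs_of_nonneg (modeWeight_nonneg ξ)]
        · filter_upwards [modeWeight_eq_zero (𝒟 := 𝒟) (i := i) (n := n) hε] with ξ hξ
          simp only [pow_one, Real.norm_eq_abs, abs_mul, abs_of_nonneg (modeWeight_nonneg ξ),
            abs_of_nonneg (heatRate_nonneg ξ)]
          by_cases hR : ‖ξ‖ ≤ modeRadius ε₀ n
          · have := heatRate_le (mem_closedBall_zero_iff.2 hR)
            have h0 : 0 ≤ |modeφ 𝒟 α u i n i₀ n₀ ξ t| * modeWeight 𝒟 i n ξ :=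
              mul_nonneg (abs_nonneg _) (modeWeight_nonneg ξ)
            calc |modeφ 𝒟 α u i n i₀ n₀ ξ t| * (heatRate ξ * modeWeight 𝒟 i n ξ)
                = heatRate ξ * (|modeφ 𝒟 α u i n i₀ n₀ ξ t| * modeWeight 𝒟 i n ξ) := by ring
              _ ≤ modeRateBound ε₀ n * (|modeφ 𝒟 α u i n i₀ n₀ ξ t| * modeWeight 𝒟 i n ξ) :=
                  mul_le_mul_of_nonneg_right this h0
          · rw [hξ (not_le.1 hR)]
            simp
    _ = modeRateBound ε₀ n * ∫ ξ, |modeφ 𝒟 α u i n i₀ n₀ ξ t| * modeWeight 𝒟 i n ξ := integral_const_mul _ _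
    _ ≤ modeRateBound ε₀ n * Real.sqrt (2 * modeScalarE 𝒟 α u i n i₀ n₀ t) :=
        mul_le_mul_of_nonneg_left (integral_abs_modeφ_mul_le hε hQ t) (modeRateBound_nonneg ε₀ n)

end Estimates2

end Literature.Analysis.FluidPDE.Tao2016
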